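import Literature.Geometry.Kaehler.ComplexTorusLineBundleRadicalGreen
import Literature.Geometry.Kaehler.ComplexTorusNondegenerateLineBundleHodgeTheorem
import Literature.Geometry.Kaehler.ComplexTorusSemipositiveLineBundleDescent
import Literature.Geometry.Kaehler.ComplexTorusLineBundleSerreDuality
import HarnessLib

/-!
# Theorem 1.6.1 and Theorem 1.6.8 (Lange 2023) for EVERY line bundle `L = L(H, χ)` on a complex torus:
# `ℋ^q(L) ≅ H^{0,q}_∂̄(X, L)` and the table of `h^q(L)`

Layer `Literature/Geometry/Kaehler`, namespace `Literature.Geometry.Kaehler.ComplexTorus`; lane `lit-hodgefound`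
(Layer A2, seat skel-2, row A2-96 = FILE 3 of the degenerate-line-bundle programme A2-94/95/96).

Setting: `X = V/Λ` a complex torus (`Φ : ℝ^ι ≃ V` the period isomorphism), `H ∈ NS(X)` an ARBITRARY hermitian form
(real `2`-form `η`, `IsNSForm Φ η`), `χ` a semicharacter, `L = L(H, χ)`; an `H`-orthogonal complex basis `e_ν = w ν` of
`V` with real diagonal `c_ν = H(e_ν, e_ν)` (`r = #{c_ν > 0}`, `s = #{c_ν < 0}`, `Z = {c_ν = 0}` spanning the radical
`Φ(Λ(L)⁰)`), positive Kähler weights `k_ν`, the Dolbeault complex `(A^{0,•}(L), ∂̄)` of the tree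
(`ComplexTorusLineBundleDolbeault`) and the harmonic spaces `ℋ^q(L)` (`ComplexTorusLineBundleHarmonicForms`).

## Main results (sorry-free, no new named facts)

* `IsNSForm.harmonicToDolbeault_surjective` + `IsNSForm.hodgeIsomorphism` — **THEOREM 1.6.1 for every `L(H, χ)`**:
  the class map `ℋ^q(L) → H^{0,q}_∂̄(X, L)`, `σ ↦ [σ]`, is surjective in every degree `q` (injective for every frame by
  row A2-79), hence a linear isomorphism `IsNSForm.hodgeIsomorphism : ℋ^q(L) ≃ₗ[ℂ] H^{0,q}_∂̄(X, L)` (Lange quotes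
  Thm. 1.6.1 from [GH]; here it is PROVED for line bundles on complex tori);
  `IsNSForm.finrank_harmonicForms_eq_finrank_dbarCohomology`, the Hodge decomposition
  `IsNSForm.harmonicForms_sup_dbarExactForms` (`Z^{0,q}_∂̄ = ℋ^q + B^{0,q}_∂̄`), and Serre duality in dimensions
  `IsNSForm.finrank_dbarCohomology_eq_finrank_dbarCohomology_inv_of_add_eq` (`h^p(L) = h^q(L⁻¹)`, `p + q = g`, §9).
* **THEOREM 1.6.8 in the `∂̄`-cohomology**: `IsNSForm.finrank_dbarCohomology_eq_choose_mul_reducedPfaffian`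
  (`h^q(L) = binom(g-r-s, q-s) · Pfr(E)` for `q ≥ s` when `L|_{K(L)⁰}` is trivial),
  `IsNSForm.finrank_dbarCohomology_eq_zero_of_lt_or_lt` (`h^q = 0` for `q < s` or `q > g - r`),
  `IsNSForm.finrank_dbarCohomology_eq_zero_of_radical_semichar_ne_one` (`h^q = 0` for all `q` when `L|_{K(L)⁰}` is
  non-trivial; the companion file `ComplexTorusLineBundleRadicalGreen` proves this case).
* **THEOREM 1.7.3 (geometric Riemann–Roch) for every `L(H, χ)`**: the Euler–Poincaré characteristic
  `dbarEulerChar` (`χ(L) = Σ_q (-1)^q dim H^{0,q}_∂̄(X, L)`, a definition with body), `IsNSForm.riemannRoch`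
  (`g! · χ(L) = ∫_X c₁(L)^{∧g}`), `IsNSForm.dbarEulerChar_eq_zero_of_diag_eq_zero` (`χ(L) = 0` for degenerate `L`,
  Thm. 1.7.1) and `IsNSForm.polarizationDegree_eq_dbarEulerChar_sq` (Cor. 1.7.2 `deg φ_L = χ(L)²`, all `L`).
* The engine, `IsNSForm.exists_harmonic_sub_mem_dbarExactForms_of_radical_trivial`: for `χ = 1` on `Λ ∩ Λ(L)⁰`, every
  `σ ∈ Z^{0,q}_∂̄(X, L)` is `σ = h + ∂̄τ` with `h ∈ ℋ^q(L)`.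

## The argument (Lange's Prop. 1.6.10 / Exercise 1.6 (2), made cohomological)

By `ComplexTorusLineBundleRadicalGreen` (`IsNSForm.sub_radVacForm_mem_dbarExactForms`), `σ - P₀σ ∈ B^{0,q}_∂̄` where the
vacuum part `P₀σ` has `Φ(Λ(L)⁰)`-INVARIANT coefficients killed by all `∂̄_r`, `r ∈ Φ(Λ(L)⁰)`. Such a family descends to
`X̄ = X/K(L)⁰` (tree `ComplexTorusSemipositiveLineBundleDescent`: `V̄ = V/Φ(Λ(L)⁰)`, the non-degenerate `H̄` with
`p^*H̄ = H`, the semicharacter `χ̄`, `a_L = a_{L̄} ∘ p`): writing `P₀σ = Σ_{A ⊆ Z} (ι_A P₀σ) ∧ dv̄_A` (`sum_wedgeZ_unwedgeZ`),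
each `ι_A P₀σ` is the pull-back of a `∂̄`-closed `(q - #A)`-form `σ̄_A` of `L̄` on `X̄`
(`pushForm_unwedgeZ_mem_dbarClosedForms`; `∂̄` commutes with `p^*`, with `∧ dv̄_A` and with `ι_A`: `dbarForm_pullForm`,
`dbarForm_wedgeZ`, `dbarForm_unwedgeZ`, `dbarForm_pushForm`). On `X̄` the line bundle `L̄` is NON-DEGENERATE, with the
`H̄`-orthogonal basis `[e_ν]`, `ν ∉ Z` (`IsNSForm.quotBasis`), so by Theorem 1.6.1 for non-degenerate bundles
(`ComplexTorusNondegenerateLineBundleHodgeTheorem`, `IsNSForm.harmonicToDolbeault_bijective_of_ne_zero`)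
`σ̄_A = h̄_A + ∂̄τ̄_A` with `h̄_A ∈ ℋ^{q-#A}(L̄)`. Pulling back, `p^*h̄_A ∧ dv̄_A ∈ ℋ^q(L)`
(`wedgeZ_pullForm_mem_harmonicForms`: coefficientwise the first-order equations of `ℋ^q_I`, Prop. 1.6.3 /
`mem_harmonicFun_iff_dbar_deltaBar`, transfer along `p` because `[e_ν] = 0`, `H(e_ν, ·) = 0` for `ν ∈ Z`) and
`ι_A P₀σ ∧ dv̄_A - p^*h̄_A ∧ dv̄_A = ∂̄(p^*τ̄_A ∧ dv̄_A)`. Summing over `A` gives `h = Σ_A p^*h̄_A ∧ dv̄_A`. This is the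
cohomological form of Lange's count `ℋ^q(L) = ⊕_{#I=q} ℋ^q_I`, `ℋ^q_I ≅ p^*ℋ(L̄) ⊗ dv̄_{I∩Z}` (§1.6.3), and of the Leray /
Künneth description `H^q(X, L) ≅ ⊕_{a+b=q} H^a(X̄, L̄) ⊗ H^b(K(L)⁰, 𝒪)` of [BirkenhakeLange2004, §3.5].

## Contents

* §1 multi-indices across `p`: `coEmb`, `coPre`, the sign `crossSign` of `dv̄_J ∧ dv̄_A`, `koszulSign_union_right`,
  `koszulSign_map_orderEmb`;
* §2 `wedgeZ` (`ρ ↦ ρ ∧ dv̄_A`), `unwedgeZ` (`σ ↦ ι_A σ`), `sum_wedgeZ_unwedgeZ`;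
* §3 letters across `p`: chain rules through `ℂ`-linear maps, lift / descent of `A^{0,0}`, `∂̄`, `δ̄` along `[·]` and `s`;
* §4 `pullForm` (`p^*`), `pushForm` (descent), the four commutation rules with `∂̄`, descent of closed vacuum forms,
  harmonic lift;
* §5 surjectivity of `ℋ^q → H^{0,q}_∂̄` ⇔ harmonic representatives;
* §6 the `H̄`-orthogonal basis `IsNSForm.quotBasis` of `V̄`;
* §7 the theorems;
* §8 Riemann–Roch for every `L(H, χ)`: `dbarEulerChar` (χ(L), definition), `IsNSForm.dbarEulerChar_eq_zero_of_diag_eq_zero`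
  (`χ(L) = 0` for degenerate `L`, Thm. 1.7.1), `IsNSForm.riemannRoch` (`g!·χ(L) = (L^g)`, Thm. 1.7.3, all `L`),
  `IsNSForm.polarizationDegree_eq_dbarEulerChar_sq` (`deg φ_L = χ(L)²`, Cor. 1.7.2, all `L`);
* §9 `IsNSForm.finrank_dbarCohomology_eq_finrank_dbarCohomology_inv_of_add_eq` (`h^p(L) = h^q(L⁻¹)`, `p + q = g`, (1.27),
  all `L`).

## References

* [Lange2023AbelianVarietiesComplex] H. Lange, *Abelian Varieties over the Complex Numbers*, Grundlehren Text
  Editions, Springer (2023): §1.5.4 Lemma 1.5.10 (p. 58), §1.6.1 Thm. 1.6.1, Lemma 1.6.2, Prop. 1.6.3 (pp. 63–65),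
  §1.6.2 (1.26), §1.6.3 (1.29)–(1.30), Prop. 1.6.10, Thm. 1.6.8 (pp. 67–69), §1.6.4 Exercise (2) (p. 71),
  §1.7.1 Thm. 1.7.1 (p0071), Cor. 1.7.2 and §1.7.2 Thm. 1.7.3 (p0072–p0073).
* [BirkenhakeLange2004] C. Birkenhake, H. Lange, *Complex Abelian Varieties*, 2nd ed., Grundlehren 302, Springer
  (2004), Ch. 3, §§3.4–3.6 (the vanishing theorem, cohomology of line bundles, Riemann–Roch).
* [HuybrechtsCG2005] D. Huybrechts, *Complex Geometry*, Springer (2005), §2.6 Def. 2.6.24, §4.1 Cor. 4.1.14.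
* [GriffithsHarris1978] P. Griffiths, J. Harris, *Principles of Algebraic Geometry* (1978), pp. 80–82, 150–152.

[cite: Lange2023AbelianVarietiesComplex, §1.6.1 Thm. 1.6.1] [cite: Lange2023AbelianVarietiesComplex, §1.6.3 Thm. 1.6.8]
-/

noncomputable section

open scoped Manifold ContDiff Topology Real ComplexConjugate Matrix
open Set Function Complex Finset Module UnitAddTorus MeasureTheory
open Literature.Analysis.Complex Literature.Analysis.FunctionSpaces

namespace Literature.Geometry.Kaehler

namespace ComplexTorus

/-! ## §1 Multi-indices across `p : X → X̄ = X/K(L)⁰`: the enumeration of the non-radical directions, signs -/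

section Indices

variable {g : ℕ} (Z : Finset (Fin g))

/-- **The increasing enumeration `j ↦ ν_j` of the complement `P = Zᶜ` of a set `Z` of frame indices** (for
`Z = {ν | c_ν = 0}` the radical directions of an `H`-orthogonal basis, Lange's `{r+s+1, …, g}` after (1.29), this
enumerates the coordinates `v_1, …, v_{r+s}` that survive on `X̄ = X/K(L)⁰`).
[cite: Lange2023AbelianVarietiesComplex, §1.6.3 (1.29)–(1.30)] -/
def coEmb : Fin (Zᶜ.card) ↪o Fin g := Zᶜ.orderEmbOfFin rfl

/-- `ν_j ∉ Z`. [cite: Lange2023AbelianVarietiesComplex, §1.6.3 (1.29)] -/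
theorem coEmb_not_mem (j : Fin (Zᶜ.card)) : coEmb Z j ∉ Z :=
  Finset.mem_compl.1 (Finset.orderEmbOfFin_mem _ _ j)

/-- Every `ν ∉ Z` is some `ν_j`. [cite: Lange2023AbelianVarietiesComplex, §1.6.3 (1.29)] -/
theorem exists_coEmb_eq {ν : Fin g} (hν : ν ∉ Z) : ∃ j, coEmb Z j = ν := by
  have h : ν ∈ Set.range (coEmb Z) := by
    rw [coEmb, Finset.range_orderEmbOfFin, Finset.mem_coe, Finset.mem_compl]
    exact hν
  exact h

/-- **The multi-index `J'` on `X̄` under a multi-index `J ⊆ P` on `X`** (`e(J') = J`).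
[cite: Lange2023AbelianVarietiesComplex, §1.6.3 (1.30)] -/
def coPre (J : Finset (Fin g)) : Finset (Fin (Zᶜ.card)) := Finset.univ.filter fun j ↦ coEmb Z j ∈ J

/-- Membership in `coPre`. [cite: Lange2023AbelianVarietiesComplex, §1.6.3 (1.30)] -/
@[simp] theorem mem_coPre {J : Finset (Fin g)} {j : Fin (Zᶜ.card)} : j ∈ coPre Z J ↔ coEmb Z j ∈ J := by
  simp [coPre]

/-- `e(coPre J) = J` for `J` disjoint from `Z`. [cite: Lange2023AbelianVarietiesComplex, §1.6.3 (1.30)] -/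
theorem map_coPre {J : Finset (Fin g)} (hJ : Disjoint J Z) : (coPre Z J).map (coEmb Z).toEmbedding = J := by
  ext ν
  simp only [Finset.mem_map, mem_coPre, RelEmbedding.coe_toEmbedding]
  constructor
  · rintro ⟨j, hj, rfl⟩
    exact hj
  · intro hν
    obtain ⟨j, rfl⟩ := exists_coEmb_eq Z (fun hZ ↦ Finset.disjoint_left.1 hJ hν hZ)
    exact ⟨j, hν, rfl⟩

/-- `coPre (e J') = J'`. [cite: Lange2023AbelianVarietiesComplex, §1.6.3 (1.30)] -/
theorem coPre_map (J' : Finset (Fin (Zᶜ.card))) : coPre Z (J'.map (coEmb Z).toEmbedding) = J' := by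
  ext j
  rw [mem_coPre, show coEmb Z j = (coEmb Z).toEmbedding j from rfl, Finset.mem_map' ]

/-- `#coPre J = #J` for `J` disjoint from `Z`. [cite: Lange2023AbelianVarietiesComplex, §1.6.3 (1.30)] -/
theorem card_coPre {J : Finset (Fin g)} (hJ : Disjoint J Z) : (coPre Z J).card = J.card := by
  conv_rhs => rw [← map_coPre Z hJ]
  rw [Finset.card_map]

/-- `coPre (J ∖ ν_j) = (coPre J) ∖ j`. [cite: Lange2023AbelianVarietiesComplex, §1.6.3 (1.30)] -/
theorem coPre_erase (J : Finset (Fin g)) (j : Fin (Zᶜ.card)) : coPre Z (J.erase (coEmb Z j)) = (coPre Z J).erase j := by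
  ext i
  simp only [mem_coPre, Finset.mem_erase, ne_eq, (coEmb Z).injective.eq_iff]

/-- `e(J')` is disjoint from `Z`. [cite: Lange2023AbelianVarietiesComplex, §1.6.3 (1.30)] -/
theorem disjoint_map_coEmb (J' : Finset (Fin (Zᶜ.card))) : Disjoint (J'.map (coEmb Z).toEmbedding) Z := by
  rw [Finset.disjoint_left]
  intro ν hν hZ
  obtain ⟨j, -, rfl⟩ := Finset.mem_map.1 hν
  exact coEmb_not_mem Z j hZ

/-- **The sign of `dv̄_J ∧ dv̄_A = ε_A(J) dv̄_{J ∪ A}`**: `ε_A(J) = (-1)^{#{(μ, a) ∈ J × A | a < μ}}` (the Koszul sign of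
sorting the concatenation `J; A`). [cite: Lange2023AbelianVarietiesComplex, §1.6.1 Lemma 1.6.2] -/
def crossSign (A J : Finset (Fin g)) : ℂ := ∏ μ ∈ J, (-1 : ℂ) ^ (A.filter (· < μ)).card

/-- `ε_A(J ∪ {ν}) = (-1)^{#{a ∈ A | a < ν}} ε_A(J)` for `ν ∉ J`. [cite: Lange2023AbelianVarietiesComplex, §1.6.1 Lemma 1.6.2] -/
theorem crossSign_insert {A J : Finset (Fin g)} {ν : Fin g} (hν : ν ∉ J) :
    crossSign A (insert ν J) = (-1) ^ (A.filter (· < ν)).card * crossSign A J :=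
  Finset.prod_insert hν

/-- `ε_A(J) = (-1)^{#{a ∈ A | a < ν}} ε_A(J ∖ ν)` for `ν ∈ J`. [cite: Lange2023AbelianVarietiesComplex, §1.6.1 Lemma 1.6.2] -/
theorem crossSign_eq_of_mem {A J : Finset (Fin g)} {ν : Fin g} (hν : ν ∈ J) :
    crossSign A J = (-1) ^ (A.filter (· < ν)).card * crossSign A (J.erase ν) := by
  conv_lhs => rw [← Finset.insert_erase hν]
  exact crossSign_insert (Finset.notMem_erase ν J)

/-- `(-1)^n (-1)^n = 1`. [folklore] -/
private theorem neg_one_pow_mul_self' (n : ℕ) : (-1 : ℂ) ^ n * (-1) ^ n = 1 := by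
  rw [← pow_add, ← two_mul, pow_mul]
  norm_num

/-- `ε_A(J)² = 1`. [cite: Lange2023AbelianVarietiesComplex, §1.6.1 Lemma 1.6.2] -/
theorem crossSign_mul_self (A J : Finset (Fin g)) : crossSign A J * crossSign A J = 1 := by
  rw [crossSign, ← Finset.prod_mul_distrib]
  exact Finset.prod_eq_one fun μ _ ↦ neg_one_pow_mul_self' _

/-- **`ε(ν, J ∪ A) = ε(ν, J) (-1)^{#{a ∈ A | a < ν}}`** for disjoint `J`, `A`. [cite: Lange2023AbelianVarietiesComplex, §1.6.1 Lemma 1.6.2] -/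
theorem koszulSign_union_right {J A : Finset (Fin g)} (h : Disjoint J A) (ν : Fin g) :
    koszulSign ν (J ∪ A) = koszulSign ν J * (-1) ^ (A.filter (· < ν)).card := by
  rw [koszulSign_apply, koszulSign_apply, Finset.filter_union,
    Finset.card_union_of_disjoint (Finset.disjoint_filter_filter h), pow_add]

/-- **Koszul signs are computed on `X̄`**: `ε(ν_j, e(J')) = ε(j, J')` for the increasing enumeration `e`.
[cite: Lange2023AbelianVarietiesComplex, §1.6.1 Lemma 1.6.2] -/
theorem koszulSign_map_orderEmb {m : ℕ} (e : Fin m ↪o Fin g) (j : Fin m) (J' : Finset (Fin m)) :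
    koszulSign (e j) (J'.map e.toEmbedding) = koszulSign j J' := by
  rw [koszulSign_apply, koszulSign_apply, Finset.filter_map, Finset.card_map]
  congr 2
  ext i
  simp only [Finset.mem_filter, Function.comp_apply, RelEmbedding.coe_toEmbedding, e.lt_iff_lt]

/-- `(J ∖ ν) ∩ Z = J ∩ Z` for `ν ∉ Z`. [folklore] -/
private theorem erase_inter_of_not_mem {J : Finset (Fin g)} {ν : Fin g} (hν : ν ∉ Z) : J.erase ν ∩ Z = J ∩ Z := by
  ext μ
  simp only [Finset.mem_inter, Finset.mem_erase]
  exact ⟨fun h ↦ ⟨h.1.2, h.2⟩, fun h ↦ ⟨⟨by rintro rfl; exact hν h.2, h.1⟩, h.2⟩⟩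

/-- `(J ∖ ν) ∖ Z = (J ∖ Z) ∖ ν`. [folklore] -/
private theorem erase_sdiff_eq (J : Finset (Fin g)) (ν : Fin g) : J.erase ν \ Z = (J \ Z).erase ν := by
  ext μ
  simp only [Finset.mem_sdiff, Finset.mem_erase]
  tauto

/-- `(J ∪ A) ∖ ν = (J ∖ ν) ∪ A` for `ν ∉ A`. [folklore] -/
private theorem union_erase_of_not_mem {J A : Finset (Fin g)} {ν : Fin g} (hν : ν ∉ A) : (J ∪ A).erase ν = J.erase ν ∪ A := by
  ext μ
  simp only [Finset.mem_erase, Finset.mem_union]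
  constructor
  · rintro ⟨hne, h | h⟩
    exacts [Or.inl ⟨hne, h⟩, Or.inr h]
  · rintro (⟨hne, h⟩ | h)
    exacts [⟨hne, Or.inl h⟩, ⟨by rintro rfl; exact hν h, Or.inr h⟩]

/-- If `J` meets `Z` and `ν ∉ Z` then `J ∖ ν` meets `Z`. [folklore] -/
private theorem not_disjoint_erase {J : Finset (Fin g)} (hJ : ¬ Disjoint J Z) {ν : Fin g} (hν : ν ∉ Z) :
    ¬ Disjoint (J.erase ν) Z := fun hd ↦ hJ (by
  rw [Finset.disjoint_left] at hd ⊢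
  intro μ hμ hμZ
  by_cases hμν : μ = ν
  · exact hν (hμν ▸ hμZ)
  · exact hd (Finset.mem_erase.2 ⟨hμν, hμ⟩) hμZ)

end Indices

/-! ## §2 `ρ ↦ ρ ∧ dv̄_A` and its inverse on coefficient families -/

section Wedge

variable {g : ℕ} {E : Type*} (Z : Finset (Fin g))

/-- **`ρ ∧ dv̄_A`** for a family `ρ` supported on multi-indices disjoint from `Z` and `A ⊆ Z`:
`(ρ ∧ dv̄_A)_I = ε_A(I ∖ Z) ρ_{I ∖ Z}` if `I ∩ Z = A`, else `0` (`dv̄_J ∧ dv̄_A = ε_A(J) dv̄_{J ∪ A}`).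
[cite: Lange2023AbelianVarietiesComplex, §1.6.1 Lemma 1.6.2] [cite: Lange2023AbelianVarietiesComplex, §1.6.2 (1.26)] -/
def wedgeZ (A : Finset (Fin g)) (ρ : Finset (Fin g) → E → ℂ) : Finset (Fin g) → E → ℂ :=
  fun I ↦ if I ∩ Z = A then crossSign A (I \ Z) • ρ (I \ Z) else 0

/-- **The `dv̄_A`-component `ι_A σ` of a family `σ`**: `(ι_A σ)_J = ε_A(J) σ_{J ∪ A}` for `J` disjoint from `Z`, else `0`;
`σ = Σ_{A ⊆ Z} (ι_A σ) ∧ dv̄_A` (`sum_wedgeZ_unwedgeZ`). [cite: Lange2023AbelianVarietiesComplex, §1.6.2 (1.26)] -/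
def unwedgeZ (A : Finset (Fin g)) (σ : Finset (Fin g) → E → ℂ) : Finset (Fin g) → E → ℂ :=
  fun J ↦ if Disjoint J Z then crossSign A J • σ (J ∪ A) else 0

variable {Z}

/-- `(ρ ∧ dv̄_A)_I` for `I ∩ Z = A`. [cite: Lange2023AbelianVarietiesComplex, §1.6.1 Lemma 1.6.2] -/
theorem wedgeZ_of_inter_eq {A I : Finset (Fin g)} (ρ : Finset (Fin g) → E → ℂ) (h : I ∩ Z = A) :
    wedgeZ Z A ρ I = crossSign A (I \ Z) • ρ (I \ Z) :=
  if_pos h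

/-- `(ρ ∧ dv̄_A)_I = 0` for `I ∩ Z ≠ A`. [cite: Lange2023AbelianVarietiesComplex, §1.6.1 Lemma 1.6.2] -/
theorem wedgeZ_of_inter_ne {A I : Finset (Fin g)} (ρ : Finset (Fin g) → E → ℂ) (h : I ∩ Z ≠ A) :
    wedgeZ Z A ρ I = 0 :=
  if_neg h

/-- `(ι_A σ)_J` for `J` disjoint from `Z`. [cite: Lange2023AbelianVarietiesComplex, §1.6.2 (1.26)] -/
theorem unwedgeZ_of_disjoint {J : Finset (Fin g)} (A : Finset (Fin g)) (σ : Finset (Fin g) → E → ℂ) (h : Disjoint J Z) :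
    unwedgeZ Z A σ J = crossSign A J • σ (J ∪ A) :=
  if_pos h

/-- `(ι_A σ)_J = 0` for `J` meeting `Z`. [cite: Lange2023AbelianVarietiesComplex, §1.6.2 (1.26)] -/
theorem unwedgeZ_of_not_disjoint {J : Finset (Fin g)} (A : Finset (Fin g)) (σ : Finset (Fin g) → E → ℂ)
    (h : ¬ Disjoint J Z) : unwedgeZ Z A σ J = 0 :=
  if_neg h

/-- `0 ∧ dv̄_A = 0`. [cite: Lange2023AbelianVarietiesComplex, §1.6.1 Lemma 1.6.2] -/
@[simp] theorem wedgeZ_zero (A : Finset (Fin g)) : wedgeZ Z A (0 : Finset (Fin g) → E → ℂ) = 0 := by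
  funext I
  by_cases h : I ∩ Z = A
  · rw [wedgeZ_of_inter_eq _ h, Pi.zero_apply, smul_zero, Pi.zero_apply]
  · rw [wedgeZ_of_inter_ne _ h, Pi.zero_apply]

/-- `ι_A 0 = 0`. [cite: Lange2023AbelianVarietiesComplex, §1.6.2 (1.26)] -/
@[simp] theorem unwedgeZ_zero (A : Finset (Fin g)) : unwedgeZ Z A (0 : Finset (Fin g) → E → ℂ) = 0 := by
  funext J
  by_cases h : Disjoint J Z
  · rw [unwedgeZ_of_disjoint _ _ h, Pi.zero_apply, smul_zero, Pi.zero_apply]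
  · rw [unwedgeZ_of_not_disjoint _ _ h, Pi.zero_apply]

/-- `(ρ - ρ') ∧ dv̄_A = ρ ∧ dv̄_A - ρ' ∧ dv̄_A`. [cite: Lange2023AbelianVarietiesComplex, §1.6.1 Lemma 1.6.2] -/
theorem wedgeZ_sub (A : Finset (Fin g)) (ρ ρ' : Finset (Fin g) → E → ℂ) :
    wedgeZ Z A (ρ - ρ') = wedgeZ Z A ρ - wedgeZ Z A ρ' := by
  funext I
  by_cases h : I ∩ Z = A
  · rw [Pi.sub_apply, wedgeZ_of_inter_eq _ h, wedgeZ_of_inter_eq _ h, wedgeZ_of_inter_eq _ h, Pi.sub_apply, smul_sub]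
  · rw [Pi.sub_apply, wedgeZ_of_inter_ne _ h, wedgeZ_of_inter_ne _ h, wedgeZ_of_inter_ne _ h, sub_zero]

/-- **`(ι_A σ) ∧ dv̄_A` is the part of `σ` on the multi-indices `I` with `I ∩ Z = A`.**
[cite: Lange2023AbelianVarietiesComplex, §1.6.2 (1.26)] -/
theorem wedgeZ_unwedgeZ {A : Finset (Fin g)} (hA : A ⊆ Z) (σ : Finset (Fin g) → E → ℂ) (I : Finset (Fin g)) :
    wedgeZ Z A (unwedgeZ Z A σ) I = if I ∩ Z = A then σ I else 0 := by
  by_cases h : I ∩ Z = A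
  · have := hA
    rw [wedgeZ_of_inter_eq _ h, if_pos h, unwedgeZ_of_disjoint _ _ Finset.sdiff_disjoint, smul_smul,
      crossSign_mul_self, one_smul, ← h, Finset.sdiff_union_inter]
  · rw [wedgeZ_of_inter_ne _ h, if_neg h]

/-- **`σ = Σ_A (ι_A σ) ∧ dv̄_A`** over any family `S` of subsets of `Z` containing `I ∩ Z` for every `I` in the support
of `σ`. [cite: Lange2023AbelianVarietiesComplex, §1.6.2 (1.26)] -/
theorem sum_wedgeZ_unwedgeZ (S : Finset (Finset (Fin g))) (hS : ∀ A ∈ S, A ⊆ Z) (σ : Finset (Fin g) → E → ℂ)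
    (hσ : ∀ I, σ I ≠ 0 → I ∩ Z ∈ S) : ∑ A ∈ S, wedgeZ Z A (unwedgeZ Z A σ) = σ := by
  funext I
  rw [Finset.sum_apply, Finset.sum_congr rfl fun A hA ↦ wedgeZ_unwedgeZ (hS A hA) σ I, Finset.sum_ite_eq]
  by_cases h : I ∩ Z ∈ S
  · rw [if_pos h]
  · rw [if_neg h]
    by_contra hne
    exact h (hσ I (Ne.symm hne))

/-- `ρ ∧ dv̄_A` raises the degree by `#A`. [cite: Lange2023AbelianVarietiesComplex, §1.6.1 Lemma 1.6.2] -/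
theorem IsHomogeneous.wedgeZ {p : ℕ} {ρ : Finset (Fin g) → E → ℂ} (hρ : IsHomogeneous p ρ) (A : Finset (Fin g)) :
    IsHomogeneous (p + A.card) (wedgeZ Z A ρ) := fun I hI ↦ by
  by_cases h : I ∩ Z = A
  · rw [wedgeZ_of_inter_eq _ h, hρ (I \ Z) ?_, smul_zero]
    intro hc
    apply hI
    rw [← Finset.card_sdiff_add_card_inter I Z, hc, h]
  · exact wedgeZ_of_inter_ne _ h

/-- `ι_A` lowers the degree by `#A` (`#A ≤ q`). [cite: Lange2023AbelianVarietiesComplex, §1.6.2 (1.26)] -/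
theorem IsHomogeneous.unwedgeZ {q : ℕ} {σ : Finset (Fin g) → E → ℂ} (hσ : IsHomogeneous q σ) {A : Finset (Fin g)}
    (hA : A ⊆ Z) (hAq : A.card ≤ q) : IsHomogeneous (q - A.card) (unwedgeZ Z A σ) := fun J hJ ↦ by
  by_cases h : Disjoint J Z
  · rw [unwedgeZ_of_disjoint _ _ h, hσ (J ∪ A) ?_, smul_zero]
    intro hc
    apply hJ
    rw [Finset.card_union_of_disjoint (h.mono_right hA)] at hc
    omega
  · exact unwedgeZ_of_not_disjoint _ _ h

/-- `IsHomogeneous` is stable under subtraction. [cite: Lange2023AbelianVarietiesComplex, §1.6.1 p0064] -/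
theorem IsHomogeneous.sub {q : ℕ} {σ τ : Finset (Fin g) → E → ℂ} (hσ : IsHomogeneous q σ) (hτ : IsHomogeneous q τ) :
    IsHomogeneous q (σ - τ) := fun I hI ↦ by
  rw [Pi.sub_apply, hσ I hI, hτ I hI, sub_zero]

end Wedge

/-! ## §3 The letters across `p : V → V̄ = V/Φ(Λ(L)⁰)`: chain rules, lift and descent of `A^{0,0}` -/

section ChainRule

variable {E F : Type*} [NormedAddCommGroup E] [NormedSpace ℂ E] [NormedAddCommGroup F] [NormedSpace ℂ F]

/-- Chain rule through a continuous `ℂ`-linear map, evaluated: `D(f ∘ L)(x)[v] = Df(Lx)[Lv]`. [folklore] -/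
private theorem fderiv_comp_clm_apply (L : E →L[ℂ] F) {f : F → ℂ} {x : E} (hf : DifferentiableAt ℝ f (L x)) (v : E) :
    fderiv ℝ (f ∘ ⇑L) x v = fderiv ℝ f (L x) (L v) := by
  have hL : HasFDerivAt (⇑L) (L.restrictScalars ℝ) x := (L.restrictScalars ℝ).hasFDerivAt
  rw [(hf.hasFDerivAt.comp x hL).fderiv]
  rfl

/-- **`∂̄_v (f ∘ L) = (∂̄_{Lv} f) ∘ L`** for a continuous `ℂ`-linear `L`. [cite: Lange2023AbelianVarietiesComplex, §1.6.1 p0064] -/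
theorem dbarAlong_comp_clm (L : E →L[ℂ] F) {f : F → ℂ} {x : E} (hf : DifferentiableAt ℝ f (L x)) (v : E) :
    dbarAlong v (f ∘ ⇑L) x = dbarAlong (L v) f (L x) := by
  rw [dbarAlong_apply, dbarAlong_apply, fderiv_comp_clm_apply L hf, fderiv_comp_clm_apply L hf, map_smul]

/-- **`∂_v (f ∘ L) = (∂_{Lv} f) ∘ L`** for a continuous `ℂ`-linear `L`. [cite: Lange2023AbelianVarietiesComplex, §1.6.1 p0064] -/
theorem delAlong_comp_clm (L : E →L[ℂ] F) {f : F → ℂ} {x : E} (hf : DifferentiableAt ℝ f (L x)) (v : E) :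
    delAlong v (f ∘ ⇑L) x = delAlong (L v) f (L x) := by
  rw [delAlong_apply, delAlong_apply, fderiv_comp_clm_apply L hf, fderiv_comp_clm_apply L hf, map_smul]

/-- `f ∘ L` is differentiable for differentiable `f`. [folklore] -/
private theorem differentiable_comp_clm (L : E →L[ℂ] F) {f : F → ℂ} (hf : Differentiable ℝ f) : Differentiable ℝ (f ∘ ⇑L) :=
  hf.comp (L.restrictScalars ℝ).differentiable

end ChainRule

section Letters

variable {ι : Type*} [Fintype ι] {E : Type*} [NormedAddCommGroup E] [NormedSpace ℂ E]
  (Φ : (ι → ℝ) ≃L[ℝ] E) (η : E [⋀^Fin 2]→L[ℝ] ℝ) {χ : (ι → ℤ) → ℂ}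

omit [Fintype ι] in
/-- `H(r, x) = 0` for `r ∈ Φ(Λ(L)⁰)` ((1.22)). [cite: Lange2023AbelianVarietiesComplex, §1.5.4 (1.22)] -/
theorem hermOf_eq_zero_of_mem_cxSpan (h11 : ∀ u v : E, η ![I • u, I • v] = η ![u, v]) {r : E}
    (hr : r ∈ cxSpan Φ (orthSubspace Φ η ⊤)) (x : E) : hermOf η r x = 0 := by
  rw [hermOf_apply, twoForm_eq_zero_of_mem_cxSpan Φ η h11 (Submodule.smul_mem _ I hr),
    twoForm_eq_zero_of_mem_cxSpan Φ η h11 hr]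
  simp

/-- `[·] : V → V̄` maps lattice vectors by the rational representation `Q` of `p`: `[Φ n] = Φ̄(Q n)`.
[cite: Lange2023AbelianVarietiesComplex, §1.5.4 Lemma 1.5.10] -/
theorem quotientMapL_latticeVec (hη : IsNSForm Φ η) (n : ι → ℤ) :
    quotientMapL Φ (orthSubspace Φ η ⊤) (latticeVec Φ n) =
      latticeVec (radQuotientPeriod Φ hη) (quotientTorusMatrix (orthSubspace Φ η ⊤) *ᵥ n) :=
  apply_latticeVec_eq Φ (radQuotientPeriod Φ hη) (analyticRep_radQuotient Φ hη) n

/-- **Pull-back of differentiable theta functions along `p : X → X̄`**: for `ḡ ∈ A^{0,0}(L̄)`, `L̄ = L(H̄, χ̄)` on `X̄`,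
`ḡ ∘ [·] ∈ A^{0,0}(L)` when `L|_{K(L)⁰}` is trivial (`a_L = a_{L̄} ∘ p`, Lemma 1.5.10).
[cite: Lange2023AbelianVarietiesComplex, §1.5.4 Lemma 1.5.10] [cite: Lange2023AbelianVarietiesComplex, §1.6.3 Prop. 1.6.10] -/
theorem comp_quotientMapL_mem_smoothTheta (hη : IsNSForm Φ η) (hχ : IsSemicharacter Φ η χ)
    (hχ1 : ∀ n : ι → ℤ, (∀ v : E, η ![latticeVec Φ n, v] = 0) → χ n = 1)
    {gbar : (E ⧸ cxSpan Φ (orthSubspace Φ η ⊤)) → ℂ}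
    (hg : gbar ∈ smoothTheta (radQuotientPeriod Φ hη)
      (canonicalFactor (radQuotientPeriod Φ hη) (descForm Φ η) (descChar Φ η χ))) :
    gbar ∘ ⇑(quotientMapL Φ (orthSubspace Φ η ⊤)) ∈ smoothTheta Φ (canonicalFactor Φ η χ) := by
  rw [mem_smoothTheta_iff] at hg ⊢
  refine ⟨hg.1.comp ((quotientMapL Φ (orthSubspace Φ η ⊤)).restrictScalars ℝ).contDiff, fun n v ↦ ?_⟩
  rw [Function.comp_apply, Function.comp_apply, map_add, quotientMapL_latticeVec Φ η hη, hg.2, quotientMapL_apply,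
    canonicalFactor_descForm_descChar Φ hη hχ hχ1]

/-- A `Φ(Λ(L)⁰)`-invariant function is recovered from `V̄`: `f(s[x]) = f(x)` for the section `s`.
[cite: Lange2023AbelianVarietiesComplex, §1.5.4 Lemma 1.5.10] -/
theorem apply_quotientSection_mk_of_invariant {f : E → ℂ}
    (hinv : ∀ x : E, ∀ r ∈ cxSpan Φ (orthSubspace Φ η ⊤), f (x + r) = f x) (x : E) :
    f (quotientSection Φ (orthSubspace Φ η ⊤) (Submodule.Quotient.mk x)) = f x := by
  have h := hinv x _ (quotientSection_mk_sub_mem Φ (orthSubspace Φ η ⊤) x)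
  rwa [show x + (quotientSection Φ (orthSubspace Φ η ⊤) (Submodule.Quotient.mk x) - x) =
    quotientSection Φ (orthSubspace Φ η ⊤) (Submodule.Quotient.mk x) by abel] at h

/-- **Descent of `Φ(Λ(L)⁰)`-invariant differentiable theta functions to `X̄`**: `f ∘ s ∈ A^{0,0}(L̄)` for
`f ∈ A^{0,0}(L)` invariant under `Φ(Λ(L)⁰)`, when `L|_{K(L)⁰}` is trivial.
[cite: Lange2023AbelianVarietiesComplex, §1.5.4 Lemma 1.5.10] [cite: Lange2023AbelianVarietiesComplex, §1.6.3 Prop. 1.6.10] -/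
theorem comp_quotientSection_mem_smoothTheta (hη : IsNSForm Φ η) (hχ : IsSemicharacter Φ η χ)
    (hχ1 : ∀ n : ι → ℤ, (∀ v : E, η ![latticeVec Φ n, v] = 0) → χ n = 1) {f : E → ℂ}
    (hf : f ∈ smoothTheta Φ (canonicalFactor Φ η χ))
    (hinv : ∀ x : E, ∀ r ∈ cxSpan Φ (orthSubspace Φ η ⊤), f (x + r) = f x) :
    f ∘ ⇑(quotientSection Φ (orthSubspace Φ η ⊤)) ∈ smoothTheta (radQuotientPeriod Φ hη)
      (canonicalFactor (radQuotientPeriod Φ hη) (descForm Φ η) (descChar Φ η χ)) := by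
  rw [mem_smoothTheta_iff] at hf ⊢
  refine ⟨hf.1.comp ((quotientSection Φ (orthSubspace Φ η ⊤)).restrictScalars ℝ).contDiff, fun m a ↦ ?_⟩
  obtain ⟨v, rfl⟩ := Submodule.Quotient.mk_surjective _ a
  have hQV : quotientTorusMatrix (orthSubspace Φ η ⊤) *ᵥ (sectionMatrix (orthSubspace Φ η ⊤) *ᵥ m) = m := by
    rw [Matrix.mulVec_mulVec, quotientTorusMatrix_mul_sectionMatrix, Matrix.one_mulVec]
  have hcf : canonicalFactor (radQuotientPeriod Φ hη) (descForm Φ η) (descChar Φ η χ) m (Submodule.Quotient.mk v) =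
      canonicalFactor Φ η χ (sectionMatrix (orthSubspace Φ η ⊤) *ᵥ m) v := by
    have h := canonicalFactor_descForm_descChar Φ hη hχ hχ1 (sectionMatrix (orthSubspace Φ η ⊤) *ᵥ m) v
    rwa [hQV] at h
  rw [Function.comp_apply, Function.comp_apply, latticeVec_radQuotientPeriod, ← Submodule.Quotient.mk_add,
    apply_quotientSection_mk_of_invariant Φ η hinv, apply_quotientSection_mk_of_invariant Φ η hinv, hf.2, hcf]

/-- **`∂̄_u (ḡ ∘ [·]) = (∂̄_{[u]} ḡ) ∘ [·]`.** [cite: Lange2023AbelianVarietiesComplex, §1.6.3 Prop. 1.6.10] -/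
theorem dbarAlong_comp_quotientMapL {gbar : (E ⧸ cxSpan Φ (orthSubspace Φ η ⊤)) → ℂ} (hg : Differentiable ℝ gbar)
    (u x : E) :
    dbarAlong u (gbar ∘ ⇑(quotientMapL Φ (orthSubspace Φ η ⊤))) x =
      dbarAlong (quotientMapL Φ (orthSubspace Φ η ⊤) u) gbar (quotientMapL Φ (orthSubspace Φ η ⊤) x) :=
  dbarAlong_comp_clm _ (hg _) u

/-- **`δ̄_u (ḡ ∘ [·]) = (δ̄_{[u]} ḡ) ∘ [·]`** (`δ̄` of `H` on `V`, of `H̄` on `V̄`; `H̄([u],[x]) = H(u,x)`).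
[cite: Lange2023AbelianVarietiesComplex, §1.6.3 Prop. 1.6.10] [cite: Lange2023AbelianVarietiesComplex, §1.5.4 (p. 58)] -/
theorem deltaBar_comp_quotientMapL (h11 : ∀ u v : E, η ![I • u, I • v] = η ![u, v])
    {gbar : (E ⧸ cxSpan Φ (orthSubspace Φ η ⊤)) → ℂ} (hg : Differentiable ℝ gbar) (u x : E) :
    deltaBar η u (gbar ∘ ⇑(quotientMapL Φ (orthSubspace Φ η ⊤))) x =
      deltaBar (descForm Φ η) (quotientMapL Φ (orthSubspace Φ η ⊤) u) gbar (quotientMapL Φ (orthSubspace Φ η ⊤) x) := by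
  rw [deltaBar_apply, deltaBar_apply, delAlong_comp_clm _ (hg _), Function.comp_apply, quotientMapL_apply,
    quotientMapL_apply, hermOf_descForm_mk_mk Φ h11]

/-- **`∂̄_{[u]} (f ∘ s) = (∂̄_u f) ∘ s`** for `f` killed by `∂̄_r`, `r ∈ Φ(Λ(L)⁰)` (`s[u] - u ∈ Φ(Λ(L)⁰)`).
[cite: Lange2023AbelianVarietiesComplex, §1.6.3 Prop. 1.6.10] -/
theorem dbarAlong_comp_quotientSection {f : E → ℂ} (hf : Differentiable ℝ f)
    (hkill : ∀ r ∈ cxSpan Φ (orthSubspace Φ η ⊤), ∀ x, dbarAlong r f x = 0) (u : E)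
    (a : E ⧸ cxSpan Φ (orthSubspace Φ η ⊤)) :
    dbarAlong (quotientMapL Φ (orthSubspace Φ η ⊤) u) (f ∘ ⇑(quotientSection Φ (orthSubspace Φ η ⊤))) a =
      dbarAlong u f (quotientSection Φ (orthSubspace Φ η ⊤) a) := by
  rw [dbarAlong_comp_clm _ (hf _),
    show quotientSection Φ (orthSubspace Φ η ⊤) (quotientMapL Φ (orthSubspace Φ η ⊤) u) =
      u + (quotientSection Φ (orthSubspace Φ η ⊤) (Submodule.Quotient.mk u) - u) by rw [quotientMapL_apply]; abel,
    dbarAlong_add_left, hkill _ (quotientSection_mk_sub_mem Φ (orthSubspace Φ η ⊤) u), add_zero]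

/-- **`δ̄_{[u]} (f ∘ s) = (δ̄_u f) ∘ s`** for `f` killed by `∂_r`, `r ∈ Φ(Λ(L)⁰)`.
[cite: Lange2023AbelianVarietiesComplex, §1.6.3 Prop. 1.6.10] -/
theorem deltaBar_comp_quotientSection (h11 : ∀ u v : E, η ![I • u, I • v] = η ![u, v]) {f : E → ℂ}
    (hf : Differentiable ℝ f) (hkill : ∀ r ∈ cxSpan Φ (orthSubspace Φ η ⊤), ∀ x, delAlong r f x = 0) (u : E)
    (a : E ⧸ cxSpan Φ (orthSubspace Φ η ⊤)) :
    deltaBar (descForm Φ η) (quotientMapL Φ (orthSubspace Φ η ⊤) u) (f ∘ ⇑(quotientSection Φ (orthSubspace Φ η ⊤))) a =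
      deltaBar η u f (quotientSection Φ (orthSubspace Φ η ⊤) a) := by
  have ha : hermOf (descForm Φ η) (quotientMapL Φ (orthSubspace Φ η ⊤) u) a =
      hermOf η u (quotientSection Φ (orthSubspace Φ η ⊤) a) := by
    conv_lhs => rw [← mk_quotientSection Φ (orthSubspace Φ η ⊤) a, quotientMapL_apply]
    exact hermOf_descForm_mk_mk Φ h11 _ _
  rw [deltaBar_apply, deltaBar_apply, delAlong_comp_clm _ (hf _), Function.comp_apply,
    show quotientSection Φ (orthSubspace Φ η ⊤) (quotientMapL Φ (orthSubspace Φ η ⊤) u) =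
      u + (quotientSection Φ (orthSubspace Φ η ⊤) (Submodule.Quotient.mk u) - u) by rw [quotientMapL_apply]; abel,
    delAlong_add_left, hkill _ (quotientSection_mk_sub_mem Φ (orthSubspace Φ η ⊤) u), add_zero, ha]

end Letters

/-! ## §4 `p^*` and descent on coefficient families; `∂̄` commutes with `p^*`, with `∧ dv̄_A` and with `ι_A` -/

section PullPush

variable {ι : Type*} [Fintype ι] {E : Type*} [NormedAddCommGroup E] [NormedSpace ℂ E]
  (Φ : (ι → ℝ) ≃L[ℝ] E) (η : E [⋀^Fin 2]→L[ℝ] ℝ) {χ : (ι → ℤ) → ℂ} {g : ℕ} (Z : Finset (Fin g))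

/-- **`p^*` on coefficient families**: for a family `τ̄ = Σ_{J'} τ̄_{J'} dv̄'_{J'}` on `X̄ = X/K(L)⁰` (frame `[e_{ν_j}]`),
`(p^*τ̄)_J = τ̄_{J'} ∘ [·]` for `J = e(J')` disjoint from `Z`, and `0` on multi-indices meeting `Z`
(`p^* dv̄'_j = dv̄_{ν_j}`). [cite: Lange2023AbelianVarietiesComplex, §1.6.3 Prop. 1.6.10] [cite: Lange2023AbelianVarietiesComplex, §1.5.4 Lemma 1.5.10] -/
def pullForm (τ : Finset (Fin (Zᶜ.card)) → (E ⧸ cxSpan Φ (orthSubspace Φ η ⊤)) → ℂ) : Finset (Fin g) → E → ℂ :=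
  fun J ↦ if Disjoint J Z then τ (coPre Z J) ∘ ⇑(quotientMapL Φ (orthSubspace Φ η ⊤)) else 0

/-- **Descent of a `Φ(Λ(L)⁰)`-invariant family to `X̄`**: `ρ̄_{J'} = ρ_{e(J')} ∘ s` for the section `s : V̄ → V`
(inverse to `pullForm` on invariant families supported off `Z`, `pullForm_pushForm`).
[cite: Lange2023AbelianVarietiesComplex, §1.6.3 Prop. 1.6.10] [cite: Lange2023AbelianVarietiesComplex, §1.5.4 Lemma 1.5.10] -/
def pushForm (ρ : Finset (Fin g) → E → ℂ) : Finset (Fin (Zᶜ.card)) → (E ⧸ cxSpan Φ (orthSubspace Φ η ⊤)) → ℂ :=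
  fun J' ↦ ρ (J'.map (coEmb Z).toEmbedding) ∘ ⇑(quotientSection Φ (orthSubspace Φ η ⊤))

variable {Z}

/-- `(p^*τ̄)_J` for `J` disjoint from `Z`. [cite: Lange2023AbelianVarietiesComplex, §1.6.3 Prop. 1.6.10] -/
theorem pullForm_of_disjoint (τ : Finset (Fin (Zᶜ.card)) → (E ⧸ cxSpan Φ (orthSubspace Φ η ⊤)) → ℂ)
    {J : Finset (Fin g)} (hJ : Disjoint J Z) :
    pullForm Φ η Z τ J = τ (coPre Z J) ∘ ⇑(quotientMapL Φ (orthSubspace Φ η ⊤)) :=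
  if_pos hJ

/-- `(p^*τ̄)_J = 0` for `J` meeting `Z`. [cite: Lange2023AbelianVarietiesComplex, §1.6.3 Prop. 1.6.10] -/
theorem pullForm_of_not_disjoint (τ : Finset (Fin (Zᶜ.card)) → (E ⧸ cxSpan Φ (orthSubspace Φ η ⊤)) → ℂ)
    {J : Finset (Fin g)} (hJ : ¬ Disjoint J Z) : pullForm Φ η Z τ J = 0 :=
  if_neg hJ

/-- Unfolding of `pushForm`. [cite: Lange2023AbelianVarietiesComplex, §1.6.3 Prop. 1.6.10] -/
theorem pushForm_apply (ρ : Finset (Fin g) → E → ℂ) (J' : Finset (Fin (Zᶜ.card))) :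
    pushForm Φ η Z ρ J' = ρ (J'.map (coEmb Z).toEmbedding) ∘ ⇑(quotientSection Φ (orthSubspace Φ η ⊤)) :=
  rfl

/-- `p^* 0 = 0`. [cite: Lange2023AbelianVarietiesComplex, §1.6.3 Prop. 1.6.10] -/
@[simp] theorem pullForm_zero : pullForm Φ η Z (0 : Finset (Fin (Zᶜ.card)) → (E ⧸ cxSpan Φ (orthSubspace Φ η ⊤)) → ℂ) = 0 := by
  funext J
  by_cases hJ : Disjoint J Z
  · rw [pullForm_of_disjoint Φ η _ hJ]; rfl
  · rw [pullForm_of_not_disjoint Φ η _ hJ]; rfl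

/-- Descent of `0` is `0`. [cite: Lange2023AbelianVarietiesComplex, §1.6.3 Prop. 1.6.10] -/
@[simp] theorem pushForm_zero : pushForm Φ η Z (0 : Finset (Fin g) → E → ℂ) = 0 := rfl

/-- `p^*` is compatible with subtraction. [cite: Lange2023AbelianVarietiesComplex, §1.6.3 Prop. 1.6.10] -/
theorem pullForm_sub (τ τ' : Finset (Fin (Zᶜ.card)) → (E ⧸ cxSpan Φ (orthSubspace Φ η ⊤)) → ℂ) :
    pullForm Φ η Z (τ - τ') = pullForm Φ η Z τ - pullForm Φ η Z τ' := by
  funext J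
  by_cases hJ : Disjoint J Z
  · rw [Pi.sub_apply, pullForm_of_disjoint Φ η _ hJ, pullForm_of_disjoint Φ η _ hJ, pullForm_of_disjoint Φ η _ hJ]; rfl
  · rw [Pi.sub_apply, pullForm_of_not_disjoint Φ η _ hJ, pullForm_of_not_disjoint Φ η _ hJ,
      pullForm_of_not_disjoint Φ η _ hJ, sub_zero]

/-- Reindexing a sum over `J ⊆ P` along the enumeration `e`. [folklore] -/
private theorem sum_map_coEmb {M : Type*} [AddCommMonoid M] (J' : Finset (Fin (Zᶜ.card))) (F : Fin g → M) :
    ∑ ν ∈ J'.map (coEmb Z).toEmbedding, F ν = ∑ j ∈ J', F (coEmb Z j) :=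
  Finset.sum_map _ _ _

/-- Reindexing a sum over `J` disjoint from `Z` along `e`. [folklore] -/
private theorem sum_eq_sum_coPre {M : Type*} [AddCommMonoid M] {J : Finset (Fin g)} (hJ : Disjoint J Z) (F : Fin g → M) :
    ∑ ν ∈ J, F ν = ∑ j ∈ coPre Z J, F (coEmb Z j) := by
  conv_lhs => rw [← map_coPre Z hJ]
  exact sum_map_coEmb (coPre Z J) F

/-- `e(J' ∖ j) = e(J') ∖ ν_j`. [folklore] -/
private theorem map_erase_coEmb (J' : Finset (Fin (Zᶜ.card))) (j : Fin (Zᶜ.card)) :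
    (J'.erase j).map (coEmb Z).toEmbedding = (J'.map (coEmb Z).toEmbedding).erase (coEmb Z j) :=
  Finset.map_erase _ _ _

/-- **`p^*` after descent is the identity** on `Φ(Λ(L)⁰)`-invariant families supported off `Z`.
[cite: Lange2023AbelianVarietiesComplex, §1.5.4 Lemma 1.5.10] -/
theorem pullForm_pushForm {ρ : Finset (Fin g) → E → ℂ} (hρZ : ∀ J, ¬ Disjoint J Z → ρ J = 0)
    (hinv : ∀ J x, ∀ r ∈ cxSpan Φ (orthSubspace Φ η ⊤), ρ J (x + r) = ρ J x) :
    pullForm Φ η Z (pushForm Φ η Z ρ) = ρ := by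
  funext J x
  by_cases hJ : Disjoint J Z
  · rw [pullForm_of_disjoint Φ η _ hJ, Function.comp_apply, pushForm_apply, Function.comp_apply, map_coPre Z hJ,
      quotientMapL_apply, apply_quotientSection_mk_of_invariant Φ η (hinv J)]
  · rw [pullForm_of_not_disjoint Φ η _ hJ, hρZ J hJ]

/-- The coefficients of `p^*τ̄` are differentiable. [cite: Lange2023AbelianVarietiesComplex, §1.6.3 Prop. 1.6.10] -/
theorem differentiable_pullForm {τ : Finset (Fin (Zᶜ.card)) → (E ⧸ cxSpan Φ (orthSubspace Φ η ⊤)) → ℂ}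
    (hτ : ∀ J', Differentiable ℝ (τ J')) (J : Finset (Fin g)) : Differentiable ℝ (pullForm Φ η Z τ J) := by
  by_cases hJ : Disjoint J Z
  · rw [pullForm_of_disjoint Φ η _ hJ]; exact differentiable_comp_clm _ (hτ _)
  · rw [pullForm_of_not_disjoint Φ η _ hJ]; exact differentiable_const (0 : ℂ)

/-- **`∂̄_{e_ν}` kills `p^*τ̄` for the radical directions `ν ∈ Z`** (`[e_ν] = 0`).
[cite: Lange2023AbelianVarietiesComplex, §1.6.3 Prop. 1.6.10] -/
theorem dbarAlong_pullForm_of_mem (b : Fin g → E) (hbZ : ∀ ν ∈ Z, b ν ∈ cxSpan Φ (orthSubspace Φ η ⊤))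
    {τ : Finset (Fin (Zᶜ.card)) → (E ⧸ cxSpan Φ (orthSubspace Φ η ⊤)) → ℂ} (hτ : ∀ J', Differentiable ℝ (τ J'))
    {ν : Fin g} (hν : ν ∈ Z) (J : Finset (Fin g)) (x : E) : dbarAlong (b ν) (pullForm Φ η Z τ J) x = 0 := by
  by_cases hJ : Disjoint J Z
  · rw [pullForm_of_disjoint Φ η _ hJ, dbarAlong_comp_quotientMapL Φ η (hτ _),
      show quotientMapL Φ (orthSubspace Φ η ⊤) (b ν) = 0 from (Submodule.Quotient.mk_eq_zero _).2 (hbZ ν hν),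
      dbarAlong_zero_dir]
  · rw [pullForm_of_not_disjoint Φ η _ hJ, dbarAlong_zero]

/-- **`∂̄ p^* = p^* ∂̄`** on coefficient families (frames `e_ν` on `X` with `e_ν ∈ Φ(Λ(L)⁰)` for `ν ∈ Z`, and `[e_{ν_j}]`
on `X̄`). [cite: Lange2023AbelianVarietiesComplex, §1.6.3 Prop. 1.6.10] [cite: HuybrechtsCG2005, §2.6 Def. 2.6.24] -/
theorem dbarForm_pullForm (b : Fin g → E) (hbZ : ∀ ν ∈ Z, b ν ∈ cxSpan Φ (orthSubspace Φ η ⊤))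
    {τ : Finset (Fin (Zᶜ.card)) → (E ⧸ cxSpan Φ (orthSubspace Φ η ⊤)) → ℂ} (hτ : ∀ J', Differentiable ℝ (τ J')) :
    dbarForm b (pullForm Φ η Z τ) =
      pullForm Φ η Z (dbarForm (fun j ↦ quotientMapL Φ (orthSubspace Φ η ⊤) (b (coEmb Z j))) τ) := by
  funext J x
  rw [dbarForm_apply]
  by_cases hJ : Disjoint J Z
  · rw [pullForm_of_disjoint Φ η _ hJ, Function.comp_apply, dbarForm_apply, sum_eq_sum_coPre hJ]
    refine Finset.sum_congr rfl fun j _ ↦ ?_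
    have hJe : J.erase (coEmb Z j) = ((coPre Z J).erase j).map (coEmb Z).toEmbedding := by
      rw [map_erase_coEmb, map_coPre Z hJ]
    rw [hJe, koszulSign_map_orderEmb, pullForm_of_disjoint Φ η _ (disjoint_map_coEmb Z _), coPre_map,
      dbarAlong_comp_quotientMapL Φ η (hτ _)]
  · rw [pullForm_of_not_disjoint Φ η _ hJ, Pi.zero_apply]
    refine Finset.sum_eq_zero fun ν _ ↦ ?_
    by_cases hνZ : ν ∈ Z
    · rw [dbarAlong_pullForm_of_mem Φ η b hbZ hτ hνZ, mul_zero]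
    · rw [pullForm_of_not_disjoint Φ η _ (not_disjoint_erase Z hJ hνZ), dbarAlong_zero, mul_zero]

omit [Fintype ι] in
/-- **`∂̄(ρ ∧ dv̄_A) = (∂̄ρ) ∧ dv̄_A`** for a family `ρ` killed by the `∂̄_{e_ν}`, `ν ∈ Z` (`dv̄_A` is `∂̄`-closed and the
terms `∂̄_{e_ν}`, `ν ∈ A ⊆ Z`, vanish). [cite: Lange2023AbelianVarietiesComplex, §1.6.1 Lemma 1.6.2] [cite: HuybrechtsCG2005, §2.6 Def. 2.6.24] -/
theorem dbarForm_wedgeZ (b : Fin g → E) {A : Finset (Fin g)} (hA : A ⊆ Z) {ρ : Finset (Fin g) → E → ℂ}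
    (hkill : ∀ ν ∈ Z, ∀ J x, dbarAlong (b ν) (ρ J) x = 0) (hdiff : ∀ J, Differentiable ℝ (ρ J)) :
    dbarForm b (wedgeZ Z A ρ) = wedgeZ Z A (dbarForm b ρ) := by
  have hk' : ∀ ν ∈ Z, ∀ J x, dbarAlong (b ν) (wedgeZ Z A ρ J) x = 0 := fun ν hν J x ↦ by
    by_cases h : J ∩ Z = A
    · rw [wedgeZ_of_inter_eq _ h, dbarAlong_const_smul ((hdiff _) _), hkill ν hν, smul_zero]
    · rw [wedgeZ_of_inter_ne _ h, dbarAlong_zero]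
  funext J x
  rw [dbarForm_apply]
  by_cases hJA : J ∩ Z = A
  · rw [wedgeZ_of_inter_eq _ hJA, Pi.smul_apply, smul_eq_mul, dbarForm_apply, Finset.mul_sum,
      ← Finset.sum_subset (Finset.sdiff_subset : J \ Z ⊆ J) (fun ν hν hν' ↦ by
        rw [hk' ν (by by_contra h; exact hν' (Finset.mem_sdiff.2 ⟨hν, h⟩)), mul_zero])]
    refine Finset.sum_congr rfl fun ν hν ↦ ?_
    have hνZ : ν ∉ Z := (Finset.mem_sdiff.1 hν).2
    have h1 : J.erase ν ∩ Z = A := by rw [erase_inter_of_not_mem Z hνZ, hJA]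
    have h2 : J.erase ν \ Z = (J \ Z).erase ν := erase_sdiff_eq Z J ν
    have h3 : J.erase ν = (J \ Z).erase ν ∪ A := by
      rw [← Finset.sdiff_union_inter (J.erase ν) Z, h2, h1]
    have hdisj : Disjoint ((J \ Z).erase ν) A :=
      Finset.disjoint_of_subset_left (Finset.erase_subset _ _) (Finset.sdiff_disjoint.mono_right hA)
    rw [wedgeZ_of_inter_eq _ h1, h2, dbarAlong_const_smul ((hdiff _) _), smul_eq_mul, h3,
      koszulSign_union_right hdisj, crossSign_eq_of_mem (A := A) hν]
    ring
  · rw [wedgeZ_of_inter_ne _ hJA, Pi.zero_apply]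
    refine Finset.sum_eq_zero fun ν _ ↦ ?_
    by_cases hνZ : ν ∈ Z
    · rw [hk' ν hνZ, mul_zero]
    · rw [wedgeZ_of_inter_ne _ (by rwa [erase_inter_of_not_mem Z hνZ]), dbarAlong_zero, mul_zero]

omit [Fintype ι] in
/-- **`∂̄(ι_A σ) = ι_A(∂̄σ)`** for a family `σ` killed by the `∂̄_{e_ν}`, `ν ∈ Z`.
[cite: Lange2023AbelianVarietiesComplex, §1.6.1 Lemma 1.6.2] [cite: HuybrechtsCG2005, §2.6 Def. 2.6.24] -/
theorem dbarForm_unwedgeZ (b : Fin g → E) {A : Finset (Fin g)} (hA : A ⊆ Z) {σ : Finset (Fin g) → E → ℂ}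
    (hkill : ∀ ν ∈ Z, ∀ I x, dbarAlong (b ν) (σ I) x = 0) (hdiff : ∀ I, Differentiable ℝ (σ I)) :
    dbarForm b (unwedgeZ Z A σ) = unwedgeZ Z A (dbarForm b σ) := by
  have hk' : ∀ ν ∈ Z, ∀ J x, dbarAlong (b ν) (unwedgeZ Z A σ J) x = 0 := fun ν hν J x ↦ by
    by_cases h : Disjoint J Z
    · rw [unwedgeZ_of_disjoint _ _ h, dbarAlong_const_smul ((hdiff _) _), hkill ν hν, smul_zero]
    · rw [unwedgeZ_of_not_disjoint _ _ h, dbarAlong_zero]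
  funext J x
  rw [dbarForm_apply]
  by_cases hJ : Disjoint J Z
  · rw [unwedgeZ_of_disjoint _ _ hJ, Pi.smul_apply, smul_eq_mul, dbarForm_apply, Finset.mul_sum,
      ← Finset.sum_subset (Finset.subset_union_left : J ⊆ J ∪ A) (fun ν hν hν' ↦ by
        rw [hkill ν (hA ((Finset.mem_union.1 hν).resolve_left hν')), mul_zero, mul_zero])]
    refine Finset.sum_congr rfl fun ν hν ↦ ?_
    have hνA : ν ∉ A := fun h ↦ Finset.disjoint_left.1 hJ hν (hA h)
    have hdisj : Disjoint (J.erase ν) A :=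
      Finset.disjoint_of_subset_left (Finset.erase_subset _ _) (hJ.mono_right hA)
    rw [unwedgeZ_of_disjoint _ _ (Finset.disjoint_of_subset_left (Finset.erase_subset _ _) hJ),
      dbarAlong_const_smul ((hdiff _) _), smul_eq_mul, union_erase_of_not_mem hνA, koszulSign_union_right hdisj,
      crossSign_eq_of_mem (A := A) hν]
    have hn := neg_one_pow_mul_self' (A.filter (· < ν)).card
    linear_combination
      (-(koszulSign ν (J.erase ν) * crossSign A (J.erase ν) * dbarAlong (b ν) (σ (J.erase ν ∪ A)) x)) * hn
  · rw [unwedgeZ_of_not_disjoint _ _ hJ, Pi.zero_apply]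
    refine Finset.sum_eq_zero fun ν _ ↦ ?_
    by_cases hνZ : ν ∈ Z
    · rw [hk' ν hνZ, mul_zero]
    · rw [unwedgeZ_of_not_disjoint _ _ (not_disjoint_erase Z hJ hνZ), dbarAlong_zero, mul_zero]

/-- **`∂̄` commutes with descent**: `∂̄ρ̄ = (∂̄ρ)‾` for a family `ρ` whose coefficients are killed by `∂̄_r`,
`r ∈ Φ(Λ(L)⁰)`. [cite: Lange2023AbelianVarietiesComplex, §1.6.3 Prop. 1.6.10] [cite: HuybrechtsCG2005, §2.6 Def. 2.6.24] -/
theorem dbarForm_pushForm (b : Fin g → E) {ρ : Finset (Fin g) → E → ℂ}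
    (hkill : ∀ r ∈ cxSpan Φ (orthSubspace Φ η ⊤), ∀ J x, dbarAlong r (ρ J) x = 0) (hdiff : ∀ J, Differentiable ℝ (ρ J)) :
    dbarForm (fun j ↦ quotientMapL Φ (orthSubspace Φ η ⊤) (b (coEmb Z j))) (pushForm Φ η Z ρ) =
      pushForm Φ η Z (dbarForm b ρ) := by
  funext J' a
  rw [dbarForm_apply, pushForm_apply, Function.comp_apply, dbarForm_apply, sum_map_coEmb]
  refine Finset.sum_congr rfl fun j _ ↦ ?_
  rw [pushForm_apply, dbarAlong_comp_quotientSection Φ η (hdiff _) (fun r hr x ↦ hkill r hr _ x), ← map_erase_coEmb,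
    koszulSign_map_orderEmb]

/-- `p^*` preserves the degree. [cite: Lange2023AbelianVarietiesComplex, §1.6.3 Prop. 1.6.10] -/
theorem IsHomogeneous.pullForm {p : ℕ} {τ : Finset (Fin (Zᶜ.card)) → (E ⧸ cxSpan Φ (orthSubspace Φ η ⊤)) → ℂ}
    (hτ : IsHomogeneous p τ) : IsHomogeneous p (pullForm Φ η Z τ) := fun J hJ ↦ by
  by_cases h : Disjoint J Z
  · rw [pullForm_of_disjoint Φ η _ h, hτ _ (by rwa [card_coPre Z h])]; rfl
  · exact pullForm_of_not_disjoint Φ η _ h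

/-- Descent preserves the degree. [cite: Lange2023AbelianVarietiesComplex, §1.6.3 Prop. 1.6.10] -/
theorem IsHomogeneous.pushForm {p : ℕ} {ρ : Finset (Fin g) → E → ℂ} (hρ : IsHomogeneous p ρ) :
    IsHomogeneous p (pushForm Φ η Z ρ) := fun J' hJ' ↦ by
  rw [pushForm_apply, hρ _ (by rwa [Finset.card_map])]; rfl

omit [Fintype ι] in
/-- `ρ ∧ dv̄_A ∈ A^{0,•}(L)` for `ρ ∈ A^{0,•}(L)`. [cite: Lange2023AbelianVarietiesComplex, §1.6.1 p0064] -/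
theorem wedgeZ_mem_formSpace {e : (ι → ℤ) → E → ℂ} {ρ : Finset (Fin g) → E → ℂ} (hρ : ρ ∈ formSpace Φ e g)
    (A : Finset (Fin g)) : wedgeZ Z A ρ ∈ formSpace Φ e g :=
  mem_formSpace_iff.2 fun I ↦ by
    by_cases h : I ∩ Z = A
    · rw [wedgeZ_of_inter_eq _ h]; exact Submodule.smul_mem _ _ (mem_formSpace_iff.1 hρ _)
    · rw [wedgeZ_of_inter_ne _ h]; exact zero_mem _

omit [Fintype ι] in
/-- `ι_A σ ∈ A^{0,•}(L)` for `σ ∈ A^{0,•}(L)`. [cite: Lange2023AbelianVarietiesComplex, §1.6.1 p0064] -/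
theorem unwedgeZ_mem_formSpace {e : (ι → ℤ) → E → ℂ} {σ : Finset (Fin g) → E → ℂ} (hσ : σ ∈ formSpace Φ e g)
    (A : Finset (Fin g)) : unwedgeZ Z A σ ∈ formSpace Φ e g :=
  mem_formSpace_iff.2 fun J ↦ by
    by_cases h : Disjoint J Z
    · rw [unwedgeZ_of_disjoint _ _ h]; exact Submodule.smul_mem _ _ (mem_formSpace_iff.1 hσ _)
    · rw [unwedgeZ_of_not_disjoint _ _ h]; exact zero_mem _

variable (Z) in
/-- **`p^*` maps `A^{0,•}(L̄)` to `A^{0,•}(L)`** (`L|_{K(L)⁰}` trivial). [cite: Lange2023AbelianVarietiesComplex, §1.5.4 Lemma 1.5.10] -/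
theorem pullForm_mem_formSpace (hη : IsNSForm Φ η) (hχ : IsSemicharacter Φ η χ)
    (hχ1 : ∀ n : ι → ℤ, (∀ v : E, η ![latticeVec Φ n, v] = 0) → χ n = 1)
    {τ : Finset (Fin (Zᶜ.card)) → (E ⧸ cxSpan Φ (orthSubspace Φ η ⊤)) → ℂ}
    (hτ : τ ∈ formSpace (radQuotientPeriod Φ hη)
      (canonicalFactor (radQuotientPeriod Φ hη) (descForm Φ η) (descChar Φ η χ)) (Zᶜ.card)) :
    pullForm Φ η Z τ ∈ formSpace Φ (canonicalFactor Φ η χ) g :=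
  mem_formSpace_iff.2 fun J ↦ by
    by_cases h : Disjoint J Z
    · rw [pullForm_of_disjoint Φ η _ h]
      exact comp_quotientMapL_mem_smoothTheta Φ η hη hχ hχ1 (mem_formSpace_iff.1 hτ _)
    · rw [pullForm_of_not_disjoint Φ η _ h]; exact zero_mem _

variable (Z) in
/-- **Descent maps invariant families of `A^{0,•}(L)` to `A^{0,•}(L̄)`** (`L|_{K(L)⁰}` trivial).
[cite: Lange2023AbelianVarietiesComplex, §1.5.4 Lemma 1.5.10] -/
theorem pushForm_mem_formSpace (hη : IsNSForm Φ η) (hχ : IsSemicharacter Φ η χ)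
    (hχ1 : ∀ n : ι → ℤ, (∀ v : E, η ![latticeVec Φ n, v] = 0) → χ n = 1) {ρ : Finset (Fin g) → E → ℂ}
    (hρ : ρ ∈ formSpace Φ (canonicalFactor Φ η χ) g)
    (hinv : ∀ J x, ∀ r ∈ cxSpan Φ (orthSubspace Φ η ⊤), ρ J (x + r) = ρ J x) :
    pushForm Φ η Z ρ ∈ formSpace (radQuotientPeriod Φ hη)
      (canonicalFactor (radQuotientPeriod Φ hη) (descForm Φ η) (descChar Φ η χ)) (Zᶜ.card) :=
  mem_formSpace_iff.2 fun _ ↦ comp_quotientSection_mem_smoothTheta Φ η hη hχ hχ1 (mem_formSpace_iff.1 hρ _) (hinv _)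

variable (Z) in
/-- **Descent of a `∂̄`-closed `Φ(Λ(L)⁰)`-invariant `q`-form killed by the radical `∂̄_r`: `(ι_A σ)‾ ∈ Z^{0,q-#A}_∂̄(X̄, L̄)`**
for every `A ⊆ Z` with `#A ≤ q`. [cite: Lange2023AbelianVarietiesComplex, §1.6.3 Prop. 1.6.10] [cite: Lange2023AbelianVarietiesComplex, §1.6.4 Exercise (2)] -/
theorem pushForm_unwedgeZ_mem_dbarClosedForms (hη : IsNSForm Φ η) (hχ : IsSemicharacter Φ η χ)
    (hχ1 : ∀ n : ι → ℤ, (∀ v : E, η ![latticeVec Φ n, v] = 0) → χ n = 1) (b : Fin g → E)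
    (hbZ : ∀ ν ∈ Z, b ν ∈ cxSpan Φ (orthSubspace Φ η ⊤)) {q : ℕ} {σ : Finset (Fin g) → E → ℂ}
    (hσ : σ ∈ dbarClosedForms Φ η χ b q)
    (hinv : ∀ I x, ∀ r ∈ cxSpan Φ (orthSubspace Φ η ⊤), σ I (x + r) = σ I x)
    (hkill : ∀ r ∈ cxSpan Φ (orthSubspace Φ η ⊤), ∀ I x, dbarAlong r (σ I) x = 0) {A : Finset (Fin g)} (hA : A ⊆ Z)
    (hAq : A.card ≤ q) :
    pushForm Φ η Z (unwedgeZ Z A σ) ∈ dbarClosedForms (radQuotientPeriod Φ hη) (descForm Φ η) (descChar Φ η χ)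
      (fun j ↦ quotientMapL Φ (orthSubspace Φ η ⊤) (b (coEmb Z j))) (q - A.card) := by
  obtain ⟨hσA, hσq, hσd⟩ := hσ
  have hdiff : ∀ I, Differentiable ℝ (σ I) := fun I ↦ differentiable_of_mem_smoothTheta (mem_formSpace_iff.1 hσA I)
  have hρA : unwedgeZ Z A σ ∈ formSpace Φ (canonicalFactor Φ η χ) g := unwedgeZ_mem_formSpace Φ hσA A
  have hρdiff : ∀ J, Differentiable ℝ (unwedgeZ Z A σ J) := fun J ↦
    differentiable_of_mem_smoothTheta (mem_formSpace_iff.1 hρA J)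
  have hρinv : ∀ J x, ∀ r ∈ cxSpan Φ (orthSubspace Φ η ⊤), unwedgeZ Z A σ J (x + r) = unwedgeZ Z A σ J x := by
    intro J x r hr
    by_cases h : Disjoint J Z
    · rw [unwedgeZ_of_disjoint _ _ h, Pi.smul_apply, Pi.smul_apply, hinv _ x r hr]
    · rw [unwedgeZ_of_not_disjoint _ _ h]; rfl
  have hρkill : ∀ r ∈ cxSpan Φ (orthSubspace Φ η ⊤), ∀ J x, dbarAlong r (unwedgeZ Z A σ J) x = 0 := by
    intro r hr J x
    by_cases h : Disjoint J Z
    · rw [unwedgeZ_of_disjoint _ _ h, dbarAlong_const_smul ((hdiff _) _), hkill r hr, smul_zero]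
    · rw [unwedgeZ_of_not_disjoint _ _ h, dbarAlong_zero]
  refine ⟨pushForm_mem_formSpace Φ η Z hη hχ hχ1 hρA hρinv, (hσq.unwedgeZ hA hAq).pushForm Φ η, ?_⟩
  rw [dbarForm_pushForm Φ η b hρkill hρdiff,
    dbarForm_unwedgeZ b hA (fun ν hν I x ↦ hkill _ (hbZ ν hν) I x) hdiff, hσd, unwedgeZ_zero, pushForm_zero]

variable (Z) in
/-- **`p^*h̄ ∧ dv̄_A` is harmonic on `X` for `h̄` harmonic on `X̄`**: `ℋ^p(L̄) ∧ dv̄_A ⊆ ℋ^{p+#A}(L)` for an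
`H`-orthogonal frame whose `Z`-vectors lie in `Φ(Λ(L)⁰)` — coefficientwise, `ḡ ∘ [·]` is killed by `∂̄_{e_ν}` and
`δ̄_{e_ν} = -∂_{e_ν}` for `ν ∈ Z`, and by `∂̄_{e_ν}` (`ν ∉ I`) resp. `δ̄_{e_ν}` (`ν ∈ I`) off `Z` because `ḡ` is.
[cite: Lange2023AbelianVarietiesComplex, §1.6.3 Prop. 1.6.10] [cite: Lange2023AbelianVarietiesComplex, §1.6.2 (1.26)] -/
theorem wedgeZ_pullForm_mem_harmonicForms (hη : IsNSForm Φ η) (hχ : IsSemicharacter Φ η χ)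
    (hχ1 : ∀ n : ι → ℤ, (∀ v : E, η ![latticeVec Φ n, v] = 0) → χ n = 1) {b : Fin g → E}
    (hb : ∀ μ ν, μ ≠ ν → hermOf η (b μ) (b ν) = 0) (hbZ : ∀ ν ∈ Z, b ν ∈ cxSpan Φ (orthSubspace Φ η ⊤))
    {k : Fin g → ℝ} (hk : ∀ ν, 0 < k ν) {p : ℕ}
    {hbar : Finset (Fin (Zᶜ.card)) → (E ⧸ cxSpan Φ (orthSubspace Φ η ⊤)) → ℂ}
    (hh : hbar ∈ (isNSForm_descForm Φ hη).harmonicForms (fun j ↦ quotientMapL Φ (orthSubspace Φ η ⊤) (b (coEmb Z j)))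
      (fun j ↦ k (coEmb Z j)) (descChar Φ η χ) p) (A : Finset (Fin g)) :
    wedgeZ Z A (pullForm Φ η Z hbar) ∈ hη.harmonicForms b k χ (p + A.card) := by
  have h11 := hη.type_one_one
  have hbq : ∀ i j, i ≠ j → hermOf (descForm Φ η) (quotientMapL Φ (orthSubspace Φ η ⊤) (b (coEmb Z i)))
      (quotientMapL Φ (orthSubspace Φ η ⊤) (b (coEmb Z j))) = 0 := fun i j hij ↦ by
    rw [quotientMapL_apply, quotientMapL_apply, hermOf_descForm_mk_mk Φ h11]
    exact hb _ _ (fun h ↦ hij ((coEmb Z).injective h))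
  have hkq : ∀ j, 0 < k (coEmb Z j) := fun j ↦ hk _
  rw [(isNSForm_descForm Φ hη).mem_harmonicForms_iff_harmonicFun hbq] at hh
  rw [hη.mem_harmonicForms_iff_harmonicFun hb]
  refine ⟨(hh.1.pullForm Φ η).wedgeZ A, fun I ↦ ?_⟩
  by_cases hI : I ∩ Z = A
  · rw [wedgeZ_of_inter_eq _ hI, pullForm_of_disjoint Φ η _ Finset.sdiff_disjoint]
    refine Submodule.smul_mem _ _ ?_
    obtain ⟨hgA, hgd, hgδ⟩ := ((isNSForm_descForm Φ hη).mem_harmonicFun_iff_dbar_deltaBar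
      (isSemicharacter_descChar Φ hη hχ) hbq hkq).1 (hh.2 (coPre Z (I \ Z)))
    have hgdiff := differentiable_of_mem_smoothTheta hgA
    refine (hη.mem_harmonicFun_iff_dbar_deltaBar hχ hb hk).2
      ⟨comp_quotientMapL_mem_smoothTheta Φ η hη hχ hχ1 hgA, fun ν hν ↦ ?_, fun ν hν ↦ ?_⟩
    · funext x
      rw [dbarAlong_comp_quotientMapL Φ η hgdiff, Pi.zero_apply]
      by_cases hνZ : ν ∈ Z
      · rw [show quotientMapL Φ (orthSubspace Φ η ⊤) (b ν) = 0 from (Submodule.Quotient.mk_eq_zero _).2 (hbZ ν hνZ),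
          dbarAlong_zero_dir]
      · obtain ⟨j, rfl⟩ := exists_coEmb_eq Z hνZ
        have hj : j ∉ coPre Z (I \ Z) := fun h ↦ hν (Finset.mem_sdiff.1 ((mem_coPre Z).1 h)).1
        have h0 := congr_fun (hgd j hj) (quotientMapL Φ (orthSubspace Φ η ⊤) x)
        rwa [Pi.zero_apply] at h0
    · funext x
      rw [deltaBar_comp_quotientMapL Φ η h11 hgdiff, Pi.zero_apply]
      by_cases hνZ : ν ∈ Z
      · rw [show quotientMapL Φ (orthSubspace Φ η ⊤) (b ν) = 0 from (Submodule.Quotient.mk_eq_zero _).2 (hbZ ν hνZ),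
          deltaBar_zero_left]
      · obtain ⟨j, rfl⟩ := exists_coEmb_eq Z hνZ
        have hj : j ∈ coPre Z (I \ Z) := (mem_coPre Z).2 (Finset.mem_sdiff.2 ⟨hν, hνZ⟩)
        have h0 := congr_fun (hgδ j hj) (quotientMapL Φ (orthSubspace Φ η ⊤) x)
        rwa [Pi.zero_apply] at h0
  · rw [wedgeZ_of_inter_ne _ hI]
    exact zero_mem _

/-- **`∂̄(p^*τ̄ ∧ dv̄_A) = p^*(∂̄τ̄) ∧ dv̄_A`.** [cite: Lange2023AbelianVarietiesComplex, §1.6.3 Prop. 1.6.10] [cite: HuybrechtsCG2005, §2.6 Def. 2.6.24] -/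
theorem dbarForm_wedgeZ_pullForm (b : Fin g → E) (hbZ : ∀ ν ∈ Z, b ν ∈ cxSpan Φ (orthSubspace Φ η ⊤))
    {A : Finset (Fin g)} (hA : A ⊆ Z)
    {τ : Finset (Fin (Zᶜ.card)) → (E ⧸ cxSpan Φ (orthSubspace Φ η ⊤)) → ℂ} (hτ : ∀ J', Differentiable ℝ (τ J')) :
    dbarForm b (wedgeZ Z A (pullForm Φ η Z τ)) =
      wedgeZ Z A (pullForm Φ η Z (dbarForm (fun j ↦ quotientMapL Φ (orthSubspace Φ η ⊤) (b (coEmb Z j))) τ)) := by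
  rw [dbarForm_wedgeZ b hA (fun ν hν J x ↦ dbarAlong_pullForm_of_mem Φ η b hbZ hτ hν J x)
    (differentiable_pullForm Φ η hτ), dbarForm_pullForm Φ η b hbZ hτ]

end PullPush

/-! ## §5 `ℋ^q(L) → H^{0,q}_∂̄(X, L)` is onto iff every closed form is cohomologous to a harmonic one -/

section HodgeSurjective

variable {ι : Type*} [Fintype ι] {E : Type*} [NormedAddCommGroup E] [NormedSpace ℂ E]
  {Φ : (ι → ℝ) ≃L[ℝ] E} {η : E [⋀^Fin 2]→L[ℝ] ℝ} {χ : (ι → ℤ) → ℂ} {g : ℕ} {b : Fin g → E} {k : Fin g → ℝ}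
  (hη : IsNSForm Φ η) (hχ : IsSemicharacter Φ η χ) (hb : ∀ μ ν, μ ≠ ν → hermOf η (b μ) (b ν) = 0)
  (hk : ∀ ν, 0 < k ν)

/-- A class in the image of `ℋ^q(L) → H^{0,q}_∂̄(X, L)` has a harmonic representative: if the map is onto, every
`σ ∈ Z^{0,q}_∂̄` is `σ = h + ∂̄τ` with `h ∈ ℋ^q(L)`. [cite: HuybrechtsCG2005, §4.1 Cor. 4.1.14] -/
theorem IsNSForm.exists_harmonic_sub_mem_dbarExactForms_of_surjective {q : ℕ}
    (hs : Function.Surjective (hη.harmonicToDolbeault (b := b) (q := q) hχ hb hk)) {σ : Finset (Fin g) → E → ℂ}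
    (hσ : σ ∈ dbarClosedForms Φ η χ b q) :
    ∃ h ∈ hη.harmonicForms b k χ q, σ - h ∈ dbarExactForms Φ η χ b q := by
  obtain ⟨h, hh⟩ := hs (dbarCohomology.mk Φ η χ b q ⟨σ, hσ⟩)
  refine ⟨h, h.2, ?_⟩
  rw [hη.harmonicToDolbeault_apply hχ hb hk, dbarCohomology.mk_eq_mk_iff, Submodule.coe_inclusion] at hh
  have e : σ - (h : Finset (Fin g) → E → ℂ) = -((h : Finset (Fin g) → E → ℂ) - σ) := by abel
  rw [e]
  exact neg_mem hh

/-- **`ℋ^q(L) → H^{0,q}_∂̄(X, L)` is onto as soon as every `∂̄`-closed `q`-form is `∂̄`-cohomologous to a harmonic one.**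
[cite: HuybrechtsCG2005, §4.1 Cor. 4.1.14] -/
theorem IsNSForm.harmonicToDolbeault_surjective_of_exists {q : ℕ}
    (H : ∀ σ ∈ dbarClosedForms Φ η χ b q, ∃ h ∈ hη.harmonicForms b k χ q, σ - h ∈ dbarExactForms Φ η χ b q) :
    Function.Surjective (hη.harmonicToDolbeault (b := b) (q := q) hχ hb hk) := fun cl ↦ by
  induction cl using Submodule.Quotient.induction_on with
  | H σ =>
    obtain ⟨h, hh, hsub⟩ := H σ σ.2
    refine ⟨⟨h, hh⟩, ?_⟩
    rw [hη.harmonicToDolbeault_apply hχ hb hk]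
    change dbarCohomology.mk Φ η χ b q _ = dbarCohomology.mk Φ η χ b q σ
    rw [dbarCohomology.mk_eq_mk_iff, Submodule.coe_inclusion]
    have e : (h : Finset (Fin g) → E → ℂ) - σ = -((σ : Finset (Fin g) → E → ℂ) - h) := by abel
    rw [e]
    exact neg_mem hsub

end HodgeSurjective

/-! ## §6 The `H̄`-orthogonal basis `[e_{ν_j}]` of `V̄ = V/Φ(Λ(L)⁰)` -/

section QuotBasis

/-- Off `Z = {c_ν = 0}` the diagonal is non-zero: `c_{ν_j} ≠ 0`. [cite: Lange2023AbelianVarietiesComplex, §1.6.3 (1.29)] -/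
theorem diag_coEmb_ne_zero {g : ℕ} (c : Fin g → ℝ) (j : Fin ((diagZero c)ᶜ.card)) : (c ∘ coEmb (diagZero c)) j ≠ 0 :=
  fun h ↦ coEmb_not_mem (diagZero c) j (mem_diagZero.2 h)

variable {ι : Type*} [Fintype ι] {E : Type*} [NormedAddCommGroup E] [NormedSpace ℂ E]
  {Φ : (ι → ℝ) ≃L[ℝ] E} {η : E [⋀^Fin 2]→L[ℝ] ℝ} {g : ℕ} {w : Module.Basis (Fin g) ℂ E} {c : Fin g → ℝ}
  (hη : IsNSForm Φ η) (horth : ∀ μ ν, hermOf η (w μ) (w ν) = if μ = ν then (c μ : ℂ) else 0)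
include hη horth

/-- **The classes `[e_ν]`, `ν ∉ Z`, are linearly independent in `V̄`** (a relation gives a radical vector
`Σ a_j e_{ν_j}`, and `0 = H(Σ a_j e_{ν_j}, e_{ν_i}) = a_i c_{ν_i}` with `c_{ν_i} ≠ 0`).
[cite: Lange2023AbelianVarietiesComplex, §1.6.3 (1.29)–(1.30)] -/
theorem IsNSForm.linearIndependent_mk_basis_coEmb :
    LinearIndependent ℂ fun j : Fin ((diagZero c)ᶜ.card) ↦
      (quotientMapL Φ (orthSubspace Φ η ⊤) (w (coEmb (diagZero c) j))) := by
  rw [Fintype.linearIndependent_iff]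
  intro a ha i
  have hmem : (∑ j, a j • w (coEmb (diagZero c) j)) ∈ cxSpan Φ (orthSubspace Φ η ⊤) := by
    rw [← Submodule.Quotient.mk_eq_zero, ← Submodule.mkQ_apply, map_sum]
    simpa only [map_smul, Submodule.mkQ_apply, quotientMapL_apply] using ha
  have h0 : hermOf η (∑ j, a j • w (coEmb (diagZero c) j)) (w (coEmb (diagZero c) i)) = 0 :=
    hη.hermOf_coe_radSpace ⟨_, hmem⟩ _
  have hrepr : w.repr (∑ j, a j • w (coEmb (diagZero c) j)) (coEmb (diagZero c) i) = a i := by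
    simp only [map_sum, map_smul, Module.Basis.repr_self, Finsupp.finsetSum_apply, Finsupp.smul_apply,
      Finsupp.single_apply, (coEmb (diagZero c)).injective.eq_iff, smul_eq_mul, mul_ite, mul_one, mul_zero,
      Finset.sum_ite_eq', Finset.mem_univ, if_true]
  rw [hermOf_basis_right_eq horth, hrepr] at h0
  exact (mul_eq_zero.1 h0).resolve_right (Complex.ofReal_ne_zero.2 (diag_coEmb_ne_zero c i))

/-- **The classes `[e_ν]`, `ν ∉ Z`, span `V̄`** (`[e_ν] = 0` for `ν ∈ Z`). [cite: Lange2023AbelianVarietiesComplex, §1.6.3 (1.29)–(1.30)] -/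
theorem IsNSForm.span_mk_basis_coEmb_eq_top :
    Submodule.span ℂ (Set.range fun j : Fin ((diagZero c)ᶜ.card) ↦
      (quotientMapL Φ (orthSubspace Φ η ⊤) (w (coEmb (diagZero c) j)))) = ⊤ := by
  refine Submodule.eq_top_iff'.2 fun a ↦ ?_
  obtain ⟨v, rfl⟩ := Submodule.Quotient.mk_surjective _ a
  rw [← w.sum_repr v, ← Submodule.mkQ_apply, map_sum]
  refine Submodule.sum_mem _ fun ν _ ↦ ?_
  rw [map_smul]
  refine Submodule.smul_mem _ _ ?_
  by_cases hν : ν ∈ diagZero c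
  · have hmem : w ν ∈ cxSpan Φ (orthSubspace Φ η ⊤) := hη.diagZero_mem_radSpace horth ν hν
    rw [Submodule.mkQ_apply, (Submodule.Quotient.mk_eq_zero _).2 hmem]
    exact zero_mem _
  · obtain ⟨j, hj⟩ := exists_coEmb_eq (diagZero c) hν
    exact Submodule.subset_span ⟨j, by rw [Submodule.mkQ_apply, ← hj]; rfl⟩

/-- **The basis `ē_j = [e_{ν_j}]` (`ν_j ∉ Z` increasing) of `V̄ = V/Φ(Λ(L)⁰)`** — Lange's coordinates `v_1, …, v_{r+s}`
of (1.30) on `X̄`. [cite: Lange2023AbelianVarietiesComplex, §1.6.3 (1.30)] [cite: Lange2023AbelianVarietiesComplex, §1.5.4 Lemma 1.5.10] -/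
def IsNSForm.quotBasis : Module.Basis (Fin ((diagZero c)ᶜ.card)) ℂ (E ⧸ cxSpan Φ (orthSubspace Φ η ⊤)) :=
  Module.Basis.mk (hη.linearIndependent_mk_basis_coEmb horth) (hη.span_mk_basis_coEmb_eq_top horth).ge

/-- `ē_j = [e_{ν_j}]`. [cite: Lange2023AbelianVarietiesComplex, §1.6.3 (1.30)] -/
theorem IsNSForm.coe_quotBasis :
    ⇑(hη.quotBasis horth) = fun j ↦ quotientMapL Φ (orthSubspace Φ η ⊤) (w (coEmb (diagZero c) j)) :=
  Module.Basis.coe_mk _ _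

/-- **`ē` is `H̄`-orthogonal with the non-zero diagonal `c_{ν_j}`** (`H̄([u],[v]) = H(u,v)`).
[cite: Lange2023AbelianVarietiesComplex, §1.6.3 (1.29)–(1.30)] [cite: Lange2023AbelianVarietiesComplex, §1.5.4 (p. 58)] -/
theorem IsNSForm.quotBasis_orth (i j : Fin ((diagZero c)ᶜ.card)) :
    hermOf (descForm Φ η) (hη.quotBasis horth i) (hη.quotBasis horth j) =
      if i = j then (((c ∘ coEmb (diagZero c)) i : ℝ) : ℂ) else 0 := by
  rw [hη.coe_quotBasis horth]
  dsimp only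
  rw [quotientMapL_apply, quotientMapL_apply, hermOf_descForm_mk_mk Φ hη.type_one_one, horth]
  by_cases hij : i = j
  · subst hij
    rw [if_pos rfl, if_pos rfl]
    rfl
  · rw [if_neg (fun h ↦ hij ((coEmb (diagZero c)).injective h)), if_neg hij]

end QuotBasis

/-! ## §7 Theorem 1.6.1 for every `L(H, χ)`; Theorem 1.6.8 in the `∂̄`-cohomology -/

section HodgeTheorem

variable {ι : Type*} [Fintype ι] [DecidableEq ι] {E : Type*} [NormedAddCommGroup E] [NormedSpace ℂ E]
  [FiniteDimensional ℂ E] {Φ : (ι → ℝ) ≃L[ℝ] E} {η : E [⋀^Fin 2]→L[ℝ] ℝ} {χ : (ι → ℤ) → ℂ} {g : ℕ}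
  {w : Module.Basis (Fin g) ℂ E} {c : Fin g → ℝ} {k : Fin g → ℝ}
  (hη : IsNSForm Φ η) (hχ : IsSemicharacter Φ η χ)
  (horth : ∀ μ ν, hermOf η (w μ) (w ν) = if μ = ν then (c μ : ℂ) else 0) (hk : ∀ ν, 0 < k ν)
include hη hχ horth hk

omit [FiniteDimensional ℂ E] horth hk in
/-- The coefficients of the vacuum part `P₀σ` are `Φ(Λ(L)⁰)`-invariant. [cite: Lange2023AbelianVarietiesComplex, §1.6.3 Prop. 1.6.10] -/
theorem IsNSForm.radVacForm_apply_add_of_mem {σ : Finset (Fin g) → E → ℂ}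
    (hσ : σ ∈ formSpace Φ (canonicalFactor Φ η χ) g) (I : Finset (Fin g)) (x : E) {r : E}
    (hr : r ∈ cxSpan Φ (orthSubspace Φ η ⊤)) : hη.radVacForm hχ σ I (x + r) = hη.radVacForm hχ σ I x :=
  (IsRadSection.of_mem_smoothTheta hη.type_one_one (mem_formSpace_iff.1 hσ I)).radVac_add_coe hη hχ x ⟨r, hr⟩

omit horth hk in
/-- The coefficients of `P₀σ` are killed by `∂̄_r`, `r ∈ Φ(Λ(L)⁰)`. [cite: Lange2023AbelianVarietiesComplex, §1.6.3 Prop. 1.6.10] -/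
theorem IsNSForm.dbarAlong_radVacForm_of_mem {σ : Finset (Fin g) → E → ℂ}
    (hσ : σ ∈ formSpace Φ (canonicalFactor Φ η χ) g) {r : E} (hr : r ∈ cxSpan Φ (orthSubspace Φ η ⊤))
    (I : Finset (Fin g)) (x : E) : dbarAlong r (hη.radVacForm hχ σ I) x = 0 :=
  (IsRadSection.of_mem_smoothTheta hη.type_one_one (mem_formSpace_iff.1 hσ I)).dbarAlong_coe_radVac hη hχ ⟨r, hr⟩ x

/-- **Harmonic representatives when `L|_{K(L)⁰}` is trivial** (`χ = 1` on `Λ ∩ Λ(L)⁰`): every `σ ∈ Z^{0,q}_∂̄(X, L)` is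
`σ = h + ∂̄τ` with `h ∈ ℋ^q(L)` — `σ ∼ P₀σ = Σ_A ι_A(P₀σ) ∧ dv̄_A`, each `ι_A(P₀σ)` descends to a closed form on
`X̄ = X/K(L)⁰` where `L̄` is non-degenerate (Theorem 1.6.1 there, row A2-93), and harmonic forms and `∂̄`-boundaries pull
back along `p` and wedge with `dv̄_A`. [cite: Lange2023AbelianVarietiesComplex, §1.6.1 Thm. 1.6.1] [cite: Lange2023AbelianVarietiesComplex, §1.6.3 Prop. 1.6.10] [cite: Lange2023AbelianVarietiesComplex, §1.6.4 Exercise (2)] -/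
theorem IsNSForm.exists_harmonic_sub_mem_dbarExactForms_of_radical_trivial
    (hχ1 : ∀ n : ι → ℤ, (∀ v : E, η ![latticeVec Φ n, v] = 0) → χ n = 1) {q : ℕ} {σ : Finset (Fin g) → E → ℂ}
    (hσ : σ ∈ dbarClosedForms Φ η χ (⇑w) q) :
    ∃ h ∈ hη.harmonicForms (⇑w) k χ q, σ - h ∈ dbarExactForms Φ η χ (⇑w) q := by
  have hZ : ∀ ν ∈ diagZero c, w ν ∈ radSpace Φ η := hη.diagZero_mem_radSpace horth
  have hbZ : ∀ ν ∈ diagZero c, (⇑w) ν ∈ cxSpan Φ (orthSubspace Φ η ⊤) := hZ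
  have hspan := hη.span_radFrame_diagZero_eq_top horth
  have hb : ∀ μ ν, μ ≠ ν → hermOf η (w μ) (w ν) = 0 := hermOf_basis_eq_zero_of_ne horth
  -- Step 1: `σ ∼ P₀σ`, and `P₀σ` is a closed form with invariant coefficients killed by the radical `∂̄_r`
  have h₁ : σ - hη.radVacForm hχ σ ∈ dbarExactForms Φ η χ (⇑w) q :=
    hη.sub_radVacForm_mem_dbarExactForms hχ hZ hspan hk hσ
  have hσ₀ : hη.radVacForm hχ σ ∈ dbarClosedForms Φ η χ (⇑w) q :=
    hη.radVacForm_mem_dbarClosedForms hχ hZ hspan hk hσ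
  have hinv : ∀ I x, ∀ r ∈ cxSpan Φ (orthSubspace Φ η ⊤),
      hη.radVacForm hχ σ I (x + r) = hη.radVacForm hχ σ I x := fun I x r hr ↦
    hη.radVacForm_apply_add_of_mem hχ hσ.1 I x hr
  have hkill : ∀ r ∈ cxSpan Φ (orthSubspace Φ η ⊤), ∀ I x, dbarAlong r (hη.radVacForm hχ σ I) x = 0 :=
    fun r hr I x ↦ hη.dbarAlong_radVacForm_of_mem hχ hσ.1 hr I x
  -- Step 2: the non-degenerate line bundle `L̄` on `X̄` and Theorem 1.6.1 there
  have hηq := isNSForm_descForm Φ hη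
  have hχq := isSemicharacter_descChar Φ hη hχ
  have horthq := hη.quotBasis_orth horth
  have hbq := hermOf_basis_eq_zero_of_ne horthq
  have hkq : ∀ j, 0 < (k ∘ coEmb (diagZero c)) j := fun j ↦ hk _
  have hsurj : ∀ p, Function.Surjective
      (hηq.harmonicToDolbeault (b := ⇑(hη.quotBasis horth)) (q := p) hχq hbq hkq) := fun p ↦
    (hηq.harmonicToDolbeault_bijective_of_ne_zero hχq horthq (diag_coEmb_ne_zero c) hkq p).2
  -- Step 3: for every `A ⊆ Z` with `#A ≤ q`, a harmonic `h_A` with `ι_A(P₀σ) ∧ dv̄_A - h_A ∈ B^{0,q}`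
  have key : ∀ A ∈ (diagZero c).powerset.filter (fun A ↦ A.card ≤ q), ∃ hA : Finset (Fin g) → E → ℂ,
      hA ∈ hη.harmonicForms (⇑w) k χ q ∧
        wedgeZ (diagZero c) A (unwedgeZ (diagZero c) A (hη.radVacForm hχ σ)) - hA ∈ dbarExactForms Φ η χ (⇑w) q := by
    intro A hAS
    obtain ⟨hAZ, hAq⟩ : A ⊆ diagZero c ∧ A.card ≤ q := by
      simpa [Finset.mem_filter, Finset.mem_powerset] using hAS
    -- the descended closed form `σ̄_A` and its harmonic representative on `X̄`
    have hcl := pushForm_unwedgeZ_mem_dbarClosedForms Φ η (diagZero c) hη hχ hχ1 (⇑w) hbZ hσ₀ hinv hkill hAZ hAq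
    rw [← hη.coe_quotBasis horth] at hcl
    obtain ⟨hb', hhb', hex⟩ := hηq.exists_harmonic_sub_mem_dbarExactForms_of_surjective hχq hbq hkq (hsurj _) hcl
    have hhb'' := hhb'
    rw [hη.coe_quotBasis horth] at hhb''
    -- its lift `p^*h̄_A ∧ dv̄_A ∈ ℋ^q(L)`
    have hlift : wedgeZ (diagZero c) A (pullForm Φ η (diagZero c) hb') ∈ hη.harmonicForms (⇑w) k χ q := by
      have h := wedgeZ_pullForm_mem_harmonicForms Φ η (diagZero c) hη hχ hχ1 hb hbZ hk hhb'' A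
      rwa [Nat.sub_add_cancel hAq] at h
    refine ⟨_, hlift, ?_⟩
    have hρZ : ∀ J, ¬ Disjoint J (diagZero c) → unwedgeZ (diagZero c) A (hη.radVacForm hχ σ) J = 0 :=
      fun J hJ ↦ unwedgeZ_of_not_disjoint _ _ hJ
    have hρinv : ∀ J x, ∀ r ∈ cxSpan Φ (orthSubspace Φ η ⊤),
        unwedgeZ (diagZero c) A (hη.radVacForm hχ σ) J (x + r) = unwedgeZ (diagZero c) A (hη.radVacForm hχ σ) J x := by
      intro J x r hr
      by_cases hJ : Disjoint J (diagZero c)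
      · rw [unwedgeZ_of_disjoint _ _ hJ, Pi.smul_apply, Pi.smul_apply, hinv _ x r hr]
      · rw [unwedgeZ_of_not_disjoint _ _ hJ]; rfl
    have hpp : pullForm Φ η (diagZero c) (pushForm Φ η (diagZero c) (unwedgeZ (diagZero c) A (hη.radVacForm hχ σ))) =
        unwedgeZ (diagZero c) A (hη.radVacForm hχ σ) := pullForm_pushForm Φ η hρZ hρinv
    have hhomq : IsHomogeneous q (wedgeZ (diagZero c) A (unwedgeZ (diagZero c) A (hη.radVacForm hχ σ))) := by
      have h := (hσ₀.2.1.unwedgeZ hAZ hAq).wedgeZ (Z := diagZero c) A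
      rwa [Nat.sub_add_cancel hAq] at h
    by_cases hlt : A.card < q
    · -- `σ̄_A - h̄_A = ∂̄τ̄_A`; lift `τ̄_A`
      obtain ⟨-, τ', hτ'A, hτ'q, hτ'd⟩ := hex
      rw [hη.coe_quotBasis horth] at hτ'd
      have hτ'diff : ∀ J', Differentiable ℝ (τ' J') := fun J' ↦
        differentiable_of_mem_smoothTheta (mem_formSpace_iff.1 hτ'A J')
      refine ⟨hhomq.sub (hη.mem_harmonicForms_iff.1 hlift).2.1, wedgeZ (diagZero c) A (pullForm Φ η (diagZero c) τ'),
        wedgeZ_mem_formSpace Φ (pullForm_mem_formSpace Φ η (diagZero c) hη hχ hχ1 hτ'A) A, ?_, ?_⟩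
      · have h := (hτ'q.pullForm Φ η).wedgeZ (Z := diagZero c) A
        rwa [show q - A.card - 1 + A.card = q - 1 by omega] at h
      · rw [dbarForm_wedgeZ_pullForm Φ η (⇑w) hbZ hAZ hτ'diff, hτ'd, pullForm_sub, wedgeZ_sub, hpp]
    · -- `#A = q`: degree `0` on `X̄`, where `B^{0,0} = 0`, so `σ̄_A = h̄_A`
      have hAeq : A.card = q := le_antisymm hAq (not_lt.1 hlt)
      have h0 : pushForm Φ η (diagZero c) (unwedgeZ (diagZero c) A (hη.radVacForm hχ σ)) - hb' = 0 := by
        rw [hAeq, Nat.sub_self, dbarExactForms_zero_eq_bot] at hex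
        exact (Submodule.mem_bot ℂ).1 hex
      have heq : wedgeZ (diagZero c) A (pullForm Φ η (diagZero c) hb') =
          wedgeZ (diagZero c) A (unwedgeZ (diagZero c) A (hη.radVacForm hχ σ)) := by
        rw [← hpp, ← (sub_eq_zero.1 h0)]
      rw [heq, sub_self]
      exact zero_mem _
  choose! hA hhA using key
  -- Step 4: `h = Σ_A h_A`
  refine ⟨∑ A ∈ (diagZero c).powerset.filter (fun A ↦ A.card ≤ q), hA A,
    Submodule.sum_mem _ fun A hAS ↦ (hhA A hAS).1, ?_⟩
  have hS : ∀ A ∈ (diagZero c).powerset.filter (fun A ↦ A.card ≤ q), A ⊆ diagZero c := fun A hAS ↦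
    Finset.mem_powerset.1 (Finset.mem_filter.1 hAS).1
  have hσS : ∀ I, hη.radVacForm hχ σ I ≠ 0 → I ∩ diagZero c ∈ (diagZero c).powerset.filter (fun A ↦ A.card ≤ q) := by
    intro I hI
    have hIq : I.card = q := by
      by_contra h
      exact hI (hσ₀.2.1 I h)
    exact Finset.mem_filter.2 ⟨Finset.mem_powerset.2 Finset.inter_subset_right,
      (Finset.card_le_card Finset.inter_subset_left).trans hIq.le⟩
  have hsum := sum_wedgeZ_unwedgeZ _ hS (hη.radVacForm hχ σ) hσS
  have e : σ - ∑ A ∈ (diagZero c).powerset.filter (fun A ↦ A.card ≤ q), hA A =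
      (σ - hη.radVacForm hχ σ) + ∑ A ∈ (diagZero c).powerset.filter (fun A ↦ A.card ≤ q),
        (wedgeZ (diagZero c) A (unwedgeZ (diagZero c) A (hη.radVacForm hχ σ)) - hA A) := by
    rw [Finset.sum_sub_distrib, hsum]
    abel
  rw [e]
  exact add_mem h₁ (Submodule.sum_mem _ fun A hAS ↦ (hhA A hAS).2)

/-- **THEOREM 1.6.1 (Lange 2023) for EVERY line bundle `L = L(H, χ)` on a complex torus: the class map
`ℋ^q(L) → H^{0,q}_∂̄(X, L)`, `σ ↦ [σ]`, is SURJECTIVE in every degree `q`** — every `∂̄`-closed `L`-valued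
`(0,q)`-form is cohomologous to a harmonic one — for every `H ∈ NS(X)`, every semicharacter `χ`, every `H`-orthogonal
complex basis and all positive Kähler weights (`L|_{K(L)⁰}` trivial: the previous theorem; non-trivial:
`ComplexTorusLineBundleRadicalGreen`). Injectivity holds for every frame (row A2-79 `harmonicToDolbeault_injective`),
so the class map is an isomorphism: `IsNSForm.hodgeIsomorphism` below (use `(hodgeIsomorphism …).bijective` for the
`Function.Bijective` form). [cite: Lange2023AbelianVarietiesComplex, §1.6.1 Thm. 1.6.1] [cite: HuybrechtsCG2005, §4.1 Cor. 4.1.14] -/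
theorem IsNSForm.harmonicToDolbeault_surjective (q : ℕ) :
    Function.Surjective (hη.harmonicToDolbeault (b := ⇑w) (q := q) hχ (hermOf_basis_eq_zero_of_ne horth) hk) := by
  by_cases h1 : radChar Φ η χ = 1
  · exact hη.harmonicToDolbeault_surjective_of_exists hχ _ hk fun σ hσ ↦
      hη.exists_harmonic_sub_mem_dbarExactForms_of_radical_trivial hχ horth hk
        ((hη.radChar_eq_one_iff (χ := χ)).1 h1) hσ
  · exact (hη.harmonicToDolbeault_basis_bijective_of_radChar_ne_one hχ horth hk h1 q).2

/-- **Hodge decomposition of the `∂̄`-closed forms, every `L(H, χ)`: `Z^{0,q}_∂̄(X, L) = ℋ^q(L) + B^{0,q}_∂̄(X, L)`**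
(the sum is direct: `ℋ^q(L) ∩ B^{0,q}_∂̄ = 0`, row A2-79 `harmonicForms_inf_dbarExactForms`).
[cite: HuybrechtsCG2005, §4.1 Thm. 4.1.13 / Cor. 4.1.14] [cite: Lange2023AbelianVarietiesComplex, §1.6.1 Thm. 1.6.1] -/
theorem IsNSForm.harmonicForms_sup_dbarExactForms (q : ℕ) :
    hη.harmonicForms (⇑w) k χ q ⊔ dbarExactForms Φ η χ (⇑w) q = dbarClosedForms Φ η χ (⇑w) q := by
  have hb : ∀ μ ν, μ ≠ ν → hermOf η (w μ) (w ν) = 0 := hermOf_basis_eq_zero_of_ne horth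
  refine le_antisymm (sup_le (hη.harmonicForms_le_dbarClosedForms hχ hb hk) (dbarExactForms_le_dbarClosedForms (⇑w) q hη hχ))
    fun σ hσ ↦ ?_
  obtain ⟨h, hh, hsub⟩ := hη.exists_harmonic_sub_mem_dbarExactForms_of_surjective hχ hb hk
    (hη.harmonicToDolbeault_surjective hχ horth hk q) hσ
  rw [show σ = h + (σ - h) by abel]
  exact Submodule.add_mem_sup hh hsub

/-- **`ℋ^q(L) ≃ₗ[ℂ] H^{0,q}_∂̄(X, L)`, the Hodge isomorphism of Theorem 1.6.1, for every `L(H, χ)`.**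
[cite: Lange2023AbelianVarietiesComplex, §1.6.1 Thm. 1.6.1] -/
def IsNSForm.hodgeIsomorphism (q : ℕ) : ↥(hη.harmonicForms (⇑w) k χ q) ≃ₗ[ℂ] dbarCohomology Φ η χ (⇑w) q :=
  LinearEquiv.ofBijective _
    ⟨hη.harmonicToDolbeault_injective hχ _ hk, hη.harmonicToDolbeault_surjective hχ horth hk q⟩

/-- The Hodge isomorphism is the class map `σ ↦ [σ]`. [cite: Lange2023AbelianVarietiesComplex, §1.6.1 Thm. 1.6.1] -/
theorem IsNSForm.hodgeIsomorphism_apply (q : ℕ) (σ : ↥(hη.harmonicForms (⇑w) k χ q)) :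
    hη.hodgeIsomorphism hχ horth hk q σ = hη.harmonicToDolbeault (b := ⇑w) hχ (hermOf_basis_eq_zero_of_ne horth) hk σ :=
  rfl

/-- **`dim_ℂ ℋ^q(L) = dim_ℂ H^{0,q}_∂̄(X, L)` for every `L(H, χ)`** (`LinearEquiv.finrank_eq` of the Hodge
isomorphism; row A2-93 has the non-degenerate case in the form `dim H^{0,q} = dim ℋ^q`).
[cite: Lange2023AbelianVarietiesComplex, §1.6.1 Thm. 1.6.1] -/
theorem IsNSForm.finrank_harmonicForms_eq_finrank_dbarCohomology (q : ℕ) :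
    Module.finrank ℂ ↥(hη.harmonicForms (⇑w) k χ q) = Module.finrank ℂ (dbarCohomology Φ η χ (⇑w) q) :=
  (hη.hodgeIsomorphism hχ horth hk q).finrank_eq

/-- **THEOREM 1.6.8 (Lange 2023), main case, in the `∂̄`-cohomology**: for `L = L(H, χ)` with `L|_{K(L)⁰}` trivial
(`χ = 1` on `Λ ∩ Λ(L)⁰`), `E = Im H` of type `d`, `r`/`s` the numbers of positive/negative eigenvalues of `H`:
`h^q(L) = dim_ℂ H^{0,q}_∂̄(X, L) = binom(g - r - s, q - s) · Pfr(d)` for every `q ≥ s` (the binomial coefficient vanishes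
for `q > g - r`). [cite: Lange2023AbelianVarietiesComplex, §1.6.3 Thm. 1.6.8] -/
theorem IsNSForm.finrank_dbarCohomology_eq_choose_mul_reducedPfaffian
    (hχ1 : ∀ n : ι → ℤ, (∀ v : E, η ![latticeVec Φ n, v] = 0) → χ n = 1) {d : Fin g → ℕ}
    (hd : IsPolarizationType Φ η d) {q : ℕ} (hsq : (negDirs η (⇑w)).card ≤ q) :
    Module.finrank ℂ (dbarCohomology Φ η χ (⇑w) q) =
      Nat.choose (g - (posDirs η (⇑w)).card - (negDirs η (⇑w)).card) (q - (negDirs η (⇑w)).card) * reducedPfaffian d := by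
  rw [← hη.finrank_harmonicForms_eq_finrank_dbarCohomology hχ horth hk,
    hη.finrank_harmonicForms_eq_choose_mul_reducedPfaffian_of_card_le hχ horth hk hχ1 hd hsq]

/-- **THEOREM 1.6.8, "`0` otherwise", part (b)** (Mumford–Kempf vanishing): `h^q(L) = 0` for `q < s` and for
`q > g - r`, every `L(H, χ)`. [cite: Lange2023AbelianVarietiesComplex, §1.6.3 Thm. 1.6.8] [cite: Lange2023AbelianVarietiesComplex, §1.6.2 Thm. 1.6.4] -/
theorem IsNSForm.finrank_dbarCohomology_eq_zero_of_lt_or_lt {q : ℕ}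
    (hq : g - (posDirs η (⇑w)).card < q ∨ q < (negDirs η (⇑w)).card) :
    Module.finrank ℂ (dbarCohomology Φ η χ (⇑w) q) = 0 := by
  rw [← hη.finrank_harmonicForms_eq_finrank_dbarCohomology hχ horth hk,
    hη.finrank_harmonicForms_eq_zero_of_lt_or_lt horth hχ hk hq]

/-- **THEOREM 1.6.8, "`0` otherwise", part (a)**: if `L|_{K(L)⁰}` is non-trivial — some radical lattice vector `λ₀`
has `χ(λ₀) ≠ 1` — then `h^q(L) = 0` for every `q`. [cite: Lange2023AbelianVarietiesComplex, §1.6.3 Thm. 1.6.8] -/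
theorem IsNSForm.finrank_dbarCohomology_eq_zero_of_radical_semichar_ne_one {n₀ : ι → ℤ}
    (hrad : ∀ v : E, η ![latticeVec Φ n₀, v] = 0) (hne : χ n₀ ≠ 1) (q : ℕ) :
    Module.finrank ℂ (dbarCohomology Φ η χ (⇑w) q) = 0 := by
  rw [← hη.finrank_harmonicForms_eq_finrank_dbarCohomology hχ horth hk,
    hη.finrank_harmonicForms_eq_zero_of_radical_semichar_ne_one hχ horth hk hrad hne]

/-- **`H^{0,q}_∂̄(X, L) = 0` for `q < s` or `q > g - r`** (as a subsingleton). [cite: Lange2023AbelianVarietiesComplex, §1.6.3 Thm. 1.6.8] -/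
theorem IsNSForm.subsingleton_dbarCohomology_of_lt_or_lt {q : ℕ}
    (hq : g - (posDirs η (⇑w)).card < q ∨ q < (negDirs η (⇑w)).card) :
    Subsingleton (dbarCohomology Φ η χ (⇑w) q) := by
  have hbot : hη.harmonicForms (⇑w) k χ q = ⊥ := (Submodule.eq_bot_iff _).2 fun σ hσ ↦
    hη.eq_zero_of_mem_harmonicForms hχ (hermOf_basis_eq_zero_of_ne horth) hk hq hσ
  haveI hs : Subsingleton ↥(hη.harmonicForms (⇑w) k χ q) := by
    rw [hbot]
    infer_instance
  exact (hη.hodgeIsomorphism hχ horth hk q).symm.toEquiv.subsingleton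

end HodgeTheorem

/-! ## §8 Theorem 1.7.1 / Theorem 1.7.3 (Riemann–Roch) for every `L(H, χ)` -/

section RiemannRoch

variable {ι : Type*} [Fintype ι] [DecidableEq ι] {E : Type*} [NormedAddCommGroup E] [NormedSpace ℂ E]
  [FiniteDimensional ℂ E] {Φ : (ι → ℝ) ≃L[ℝ] E} {η : E [⋀^Fin 2]→L[ℝ] ℝ} {χ : (ι → ℤ) → ℂ} {g : ℕ}
  {w : Module.Basis (Fin g) ℂ E} {c : Fin g → ℝ}
  (hη : IsNSForm Φ η) (hχ : IsSemicharacter Φ η χ)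
  (horth : ∀ μ ν, hermOf η (w μ) (w ν) = if μ = ν then (c μ : ℂ) else 0)

omit [Fintype ι] [DecidableEq ι] [FiniteDimensional ℂ E] in
/-- **The Euler–Poincaré characteristic of the `∂̄`-cohomology, `χ(L) = Σ_{q=0}^{g} (-1)^q dim_ℂ H^{0,q}_∂̄(X, L)`**
(`H^{0,q}_∂̄ = 0` for `q > g`), for `L = L(H, χ)` read in a frame `b` of `V` — Lange's `χ(L) := Σ (-1)^ν h^ν(L)`.
[cite: Lange2023AbelianVarietiesComplex, §1.7 (p0071: "χ(L) = Σ_{ν=0}^{g} (-1)^ν h^ν(L)")] -/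
def dbarEulerChar (Φ : (ι → ℝ) ≃L[ℝ] E) (η : E [⋀^Fin 2]→L[ℝ] ℝ) (χ : (ι → ℤ) → ℂ) (b : Fin g → E) : ℤ :=
  ∑ q ∈ Finset.range (g + 1), (-1 : ℤ) ^ q * (Module.finrank ℂ (dbarCohomology Φ η χ b q) : ℤ)

omit [Fintype ι] [DecidableEq ι] [FiniteDimensional ℂ E] in
/-- Unfolding of `dbarEulerChar`. [cite: Lange2023AbelianVarietiesComplex, §1.7 (p0071)] -/
theorem dbarEulerChar_def (Φ : (ι → ℝ) ≃L[ℝ] E) (η : E [⋀^Fin 2]→L[ℝ] ℝ) (χ : (ι → ℤ) → ℂ) (b : Fin g → E) :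
    dbarEulerChar Φ η χ b = ∑ q ∈ Finset.range (g + 1), (-1 : ℤ) ^ q * (Module.finrank ℂ (dbarCohomology Φ η χ b q) : ℤ) :=
  rfl

include hη hχ horth

/-- **THEOREM 1.7.1 (analytic Riemann–Roch), degenerate case: `χ(L) = Σ_q (-1)^q h^q(L) = 0` for a DEGENERATE
`L = L(H, χ)`** (some `c_{ν₀} = 0`) — from Theorem 1.6.8: all `h^q = 0` if `L|_{K(L)⁰}` is non-trivial, and otherwise
`Σ_{q=s}^{g-r} (-1)^q binom(g-r-s, q-s) Pfr(E) = 0` by `Σ_i (-1)^i binom(n, i) = 0` (`n = g - r - s ≥ 1`).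
[cite: Lange2023AbelianVarietiesComplex, §1.7.1 Thm. 1.7.1 (statement p0071 L27; proof p0072 L1–L7)] [cite: Lange2023AbelianVarietiesComplex, §1.6.3 Thm. 1.6.8] -/
theorem IsNSForm.dbarEulerChar_eq_zero_of_diag_eq_zero {ν₀ : Fin g} (hν₀ : c ν₀ = 0) :
    dbarEulerChar Φ η χ (⇑w) = 0 := by
  rw [dbarEulerChar_def]
  have hk1 : ∀ ν : Fin g, (0 : ℝ) < (fun _ : Fin g ↦ (1 : ℝ)) ν := fun _ ↦ one_pos
  have hb : ∀ μ ν, μ ≠ ν → hermOf η (w μ) (w ν) = 0 := hermOf_basis_eq_zero_of_ne horth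
  have hfin : ∀ q, Module.finrank ℂ (dbarCohomology Φ η χ (⇑w) q) =
      Module.finrank ℂ ↥(hη.harmonicForms (⇑w) (fun _ : Fin g ↦ (1 : ℝ)) χ q) := fun q ↦
    (hη.finrank_harmonicForms_eq_finrank_dbarCohomology hχ horth hk1 q).symm
  by_cases h1 : radChar Φ η χ = 1
  swap
  · refine Finset.sum_eq_zero fun q _ ↦ ?_
    rw [hη.finrank_dbarCohomology_basis_of_radChar_ne_one hχ horth hk1 h1 q, Nat.cast_zero, mul_zero]
  -- sizes: `r + s + 1 ≤ g` because `ν₀` is neither a positive nor a negative direction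
  obtain ⟨r, hr⟩ : ∃ r, (posDirs η (⇑w)).card = r := ⟨_, rfl⟩
  obtain ⟨s, hs⟩ : ∃ s, (negDirs η (⇑w)).card = s := ⟨_, rfl⟩
  obtain ⟨M, hM⟩ : ∃ M, Module.finrank ℂ ↥(hη.harmonicFun (⇑w) (fun _ : Fin g ↦ (1 : ℝ)) χ (negDirs η (⇑w))) = M :=
    ⟨_, rfl⟩
  have hdisj : Disjoint (posDirs η (⇑w)) (negDirs η (⇑w)) := Finset.disjoint_left.2 fun ν h₁ h₂ ↦ by
    rw [mem_posDirs] at h₁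
    rw [mem_negDirs] at h₂
    exact lt_asymm h₁ h₂
  have hsub : posDirs η (⇑w) ∪ negDirs η (⇑w) ⊆ Finset.univ.erase ν₀ := fun ν hν ↦ by
    rw [Finset.mem_erase]
    refine ⟨?_, Finset.mem_univ _⟩
    rintro rfl
    rw [Finset.mem_union, mem_posDirs, mem_negDirs, twoForm_I_smul_basis_self horth, hν₀] at hν
    exact hν.elim (lt_irrefl _) (lt_irrefl _)
  have hrs : r + s + 1 ≤ g := by
    have h := Finset.card_le_card hsub
    rw [Finset.card_union_of_disjoint hdisj, Finset.card_erase_of_mem (Finset.mem_univ _), Finset.card_univ,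
      Fintype.card_fin, hr, hs] at h
    have hg : 0 < g := Fin.pos ν₀
    omega
  -- the table of Theorem 1.6.8 at the harmonic level, weights `1`
  have hterm : ∀ q, (-1 : ℤ) ^ q * (Module.finrank ℂ (dbarCohomology Φ η χ (⇑w) q) : ℤ) =
      (-1 : ℤ) ^ q * (if s ≤ q then (((g - r - s).choose (q - s) * M : ℕ) : ℤ) else 0) := by
    intro q
    by_cases hsq : s ≤ q
    · rw [if_pos hsq, hfin, hη.finrank_harmonicForms hχ hb hk1 (by rw [hs]; exact hsq), hr, hs, hM]
    · rw [if_neg hsq, hfin, hη.finrank_harmonicForms_eq_zero_of_lt_or_lt horth hχ hk1 (Or.inr (by rw [hs]; omega)),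
        Nat.cast_zero]
  rw [Finset.sum_congr rfl fun q _ ↦ hterm q, Finset.range_eq_Ico,
    ← Finset.sum_Ico_consecutive _ (Nat.zero_le s) (by omega : s ≤ g + 1),
    Finset.sum_eq_zero fun q hq ↦ by
      rw [Finset.mem_Ico] at hq
      rw [if_neg (by omega), mul_zero],
    zero_add, Finset.sum_Ico_eq_sum_range]
  have hshift : ∀ j, ((-1 : ℤ) ^ (s + j) * if s ≤ s + j then (((g - r - s).choose (s + j - s) * M : ℕ) : ℤ) else 0) =
      (-1) ^ s * (M : ℤ) * ((-1) ^ j * ((g - r - s).choose j : ℤ)) := by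
    intro j
    rw [if_pos (Nat.le_add_right s j), Nat.add_sub_cancel_left, pow_add]
    push_cast
    ring
  rw [Finset.sum_congr rfl fun j _ ↦ hshift j, ← Finset.mul_sum]
  have ht : g - r - s ≠ 0 := by omega
  have halt : ∑ j ∈ Finset.range (g + 1 - s), (-1 : ℤ) ^ j * ((g - r - s).choose j : ℤ) = 0 := by
    have hsub' : Finset.range (g - r - s + 1) ⊆ Finset.range (g + 1 - s) := fun j hj ↦
      Finset.mem_range.2 (lt_of_lt_of_le (Finset.mem_range.1 hj) (by omega))
    rw [← Finset.sum_subset hsub' (fun j hj hj' ↦ by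
      rw [Finset.mem_range] at hj hj'
      rw [Nat.choose_eq_zero_of_lt (by omega), Nat.cast_zero, mul_zero])]
    exact Int.alternating_sum_range_choose_of_ne ht
  rw [halt, mul_zero]

/-- **THEOREM 1.7.3 (geometric Riemann–Roch, Lange 2023) for EVERY line bundle `L = L(H, χ)` on a complex torus:
`g! · χ(L) = (L^g)`**, with `χ(L) = Σ_{q=0}^{g} (-1)^q dim_ℂ H^{0,q}_∂̄(X, L)` and `(L^g) = ∫_X c₁(L)^{∧g} = ∫_X (-E)^{∧g}`
(non-degenerate `L`: row A2-93's `riemannRoch_of_nondegenerate`; degenerate `L`: both sides are `0` —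
`∧^g c₁(L) = 0`, `wedgePow_ofRealForm_eq_zero_of_degenerate`, and `χ(L) = 0` by the previous theorem).
[cite: Lange2023AbelianVarietiesComplex, §1.7.2 Thm. 1.7.3] [cite: Lange2023AbelianVarietiesComplex, §1.7.1 Thm. 1.7.1] -/
theorem IsNSForm.riemannRoch (e : Fin (2 * g) ≃ ι) :
    (g.factorial : ℂ) * (dbarEulerChar Φ η χ (⇑w) : ℂ) = torusIntegral Φ e (wedgePow (ofRealForm (-η)) g) := by
  by_cases hc : ∀ ν, c ν ≠ 0
  · obtain ⟨d, hd, -⟩ := hη.exists_isPolarizationType_of_orthogonal horth hc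
    rw [dbarEulerChar_def]
    push_cast
    exact hη.riemannRoch_of_nondegenerate hχ horth hc hd e
  · push Not at hc
    obtain ⟨ν₀, hν₀⟩ := hc
    have hmem : w ν₀ ∈ cxSpan Φ (orthSubspace Φ η ⊤) := hη.basis_mem_radSpace_of_diag_eq_zero horth hν₀
    have hu : ∀ x, (-η) ![w ν₀, x] = 0 := fun x ↦ by
      rw [ContinuousAlternatingMap.neg_apply, twoForm_eq_zero_of_mem_cxSpan Φ η hη.type_one_one hmem x, neg_zero]
    rw [wedgePow_ofRealForm_eq_zero_of_degenerate Φ e (-η) (w.ne_zero ν₀) hu, torusIntegral_zero,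
      hη.dbarEulerChar_eq_zero_of_diag_eq_zero hχ horth hν₀, Int.cast_zero, mul_zero]

/-- **THEOREM 1.7.1 (analytic Riemann–Roch), degenerate case, intrinsic form: `χ(L) = 0` for every `L = L(H, χ)` with
DEGENERATE `H`** (the printed value `χ(L) = (-1)^s Pf(E)` with `Pf(E) = 0`; `H` degenerate iff some diagonal entry
`c_ν` of an `H`-orthogonal basis vanishes, `nondegenerate_of_diag_ne_zero`).
[cite: Lange2023AbelianVarietiesComplex, §1.7.1 Thm. 1.7.1] -/
theorem IsNSForm.dbarEulerChar_eq_zero_of_not_nondegenerate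
    (hdeg : ¬ ∀ v : E, v ≠ 0 → ∃ u : E, η ![v, u] ≠ 0) : dbarEulerChar Φ η χ (⇑w) = 0 := by
  by_cases hc : ∀ ν, c ν ≠ 0
  · exact absurd (nondegenerate_of_diag_ne_zero horth hη.type_one_one hc) hdeg
  · push Not at hc
    obtain ⟨ν₀, hν₀⟩ := hc
    exact hη.dbarEulerChar_eq_zero_of_diag_eq_zero hχ horth hν₀

omit [FiniteDimensional ℂ E] hη hχ horth in
/-- **A degenerate `η` has `det(E|_Λ) = 0`** (`deg φ_L = det E = Pf(E)² = 0`: a non-zero radical vector `u` gives the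
kernel vector `Φ⁻¹u` of the Gram matrix). [cite: Lange2023AbelianVarietiesComplex, §1.7.1 (proof of Thm. 1.7.1: "`Pf(E) = 0`, since `L` is necessarily degenerate")] [cite: Lange2023AbelianVarietiesComplex, §1.4.2 Prop. 1.4.7] -/
theorem det_latticeGram_eq_zero_of_degenerate {u : E} (hu0 : u ≠ 0) (hu : ∀ v : E, η ![u, v] = 0) :
    (latticeGram Φ η).det = 0 := by
  by_contra hdet
  have hB' : (Matrix.toBilin' (latticeGram Φ η)).Nondegenerate :=
    LinearMap.BilinForm.nondegenerate_toBilin'_iff_det_ne_zero.mpr hdet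
  have hB : (latticeBilin Φ η).Nondegenerate := by
    rwa [latticeGram, Matrix.toBilin'_toMatrix'] at hB'
  have hsep := (LinearMap.IsAlt.isRefl (latticeBilin_isAlt Φ η)).nondegenerate_iff_separatingLeft.mp hB
  have hx : Φ.symm u = 0 := hsep (Φ.symm u) fun y ↦ by simpa using hu (Φ y)
  exact hu0 (by simpa using congrArg Φ hx)

/-- **COROLLARY 1.7.2 (Lange 2023) for EVERY `L = L(H, χ)`: `deg φ_L = χ(L)²`** with `deg φ_L = det(E|_Λ)`
(`polarizationDegree`) and `χ(L) = Σ_q (-1)^q dim_ℂ H^{0,q}_∂̄(X, L)` — non-degenerate `L`: row A2-93; degenerate `L`: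
`0 = 0²`. [cite: Lange2023AbelianVarietiesComplex, §1.7.1 Cor. 1.7.2] -/
theorem IsNSForm.polarizationDegree_eq_dbarEulerChar_sq :
    polarizationDegree Φ η = ((dbarEulerChar Φ η χ (⇑w) : ℤ) : ℝ) ^ 2 := by
  by_cases hc : ∀ ν, c ν ≠ 0
  · rw [dbarEulerChar_def]
    exact hη.polarizationDegree_eq_eulerChar_dbarCohomology_sq hχ horth hc
  · push Not at hc
    obtain ⟨ν₀, hν₀⟩ := hc
    have hmem : w ν₀ ∈ cxSpan Φ (orthSubspace Φ η ⊤) := hη.basis_mem_radSpace_of_diag_eq_zero horth hν₀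
    rw [hη.dbarEulerChar_eq_zero_of_diag_eq_zero hχ horth hν₀, Int.cast_zero, zero_pow two_ne_zero,
      polarizationDegree_eq_det]
    exact det_latticeGram_eq_zero_of_degenerate (w.ne_zero ν₀)
      (fun v ↦ twoForm_eq_zero_of_mem_cxSpan Φ η hη.type_one_one hmem v)

end RiemannRoch

/-! ## §9 Serre duality in dimensions, `h^q(L) = h^{g-q}(L⁻¹)`, for every `L(H, χ)` -/

section SerreDuality

variable {ι : Type*} [Fintype ι] [DecidableEq ι] {E : Type*} [NormedAddCommGroup E] [NormedSpace ℂ E]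
  [FiniteDimensional ℂ E] {Φ : (ι → ℝ) ≃L[ℝ] E} {η : E [⋀^Fin 2]→L[ℝ] ℝ} {χ : (ι → ℤ) → ℂ} {g : ℕ}
  {w : Module.Basis (Fin g) ℂ E} {c : Fin g → ℝ} {k : Fin g → ℝ}
  (hη : IsNSForm Φ η) (hχ : IsSemicharacter Φ η χ)
  (horth : ∀ μ ν, hermOf η (w μ) (w ν) = if μ = ν then (c μ : ℂ) else 0) (hk : ∀ ν, 0 < k ν)
include hη hχ horth hk

/-- **`h^p(L) = h^q(L⁻¹)` whenever `p + q = g`, for EVERY `L = L(H, χ)` on a complex torus of dimension `g`**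
(`L⁻¹ = L(-H, χ⁻¹)`; Lange's "`K_X = 𝒪_X` (1.27), hence the duality gives `H^q(L) ≃ H^{g-q}(L^{-1})`") — Theorem 1.6.1
for `L` and for `L⁻¹` (this file) and the Serre-duality isomorphism `ℋ^p(L) ≅ ℋ^{g-p}(L⁻¹)` of row A2-80
(`IsNSForm.finrank_harmonicForms_eq_finrank_serreDual`); row A2-93 has the non-degenerate case in the form
`h^q(L) = h^{g-q}(L⁻¹)`, `q ≤ g`. [cite: Lange2023AbelianVarietiesComplex, §1.6.2 (1.27), p0067 L27–L31] [cite: HuybrechtsCG2005, §4.1 Cor. 4.1.16] -/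
theorem IsNSForm.finrank_dbarCohomology_eq_finrank_dbarCohomology_inv_of_add_eq {p q : ℕ} (hpq : p + q = g) :
    Module.finrank ℂ (dbarCohomology Φ η χ (⇑w) p) = Module.finrank ℂ (dbarCohomology Φ (-η) χ⁻¹ (⇑w) q) := by
  have hp : p ≤ g := hpq ▸ Nat.le_add_right p q
  obtain rfl : q = g - p := by omega
  rw [← hη.finrank_harmonicForms_eq_finrank_dbarCohomology hχ horth hk,
    ← hη.neg.finrank_harmonicForms_eq_finrank_dbarCohomology hχ.inv (hermOf_neg_basis_basis horth) hk,
    hη.finrank_harmonicForms_eq_finrank_serreDual hχ (hermOf_basis_eq_zero_of_ne horth) hk hp]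

end SerreDuality

end ComplexTorus

end Literature.Geometry.Kaehler
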